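import Literature.Analysis.FluidPDE.SelfSimilarEulerPressureShellBound
import Literature.Analysis.FluidPDE.SelfSimilarEulerEnergyBootstrap
import Literature.Analysis.FluidPDE.NormalisedPressureLpClass
import HarnessLib

/-!
# Chae–Shvydkoy 2013, Theorem 3.1: at the energy-conserving scaling `α = N/2` a locally
# self-similar Euler collapse whose profile has a POWER SPREAD is trivial

Analysis/FluidPDE proof file (theorems only; no definitions, no named facts, no `sorry`) in the story
of `SelfSimilarEulerEnergyConcentration.lean` / `SelfSimilarEulerPressureShellBound.lean` /
`SelfSimilarEulerEnergyBootstrap.lean` (Bronzi–Shvydkoy 2015, scaling `0 < α < 3/2`) and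
`SelfSimilarEulerPressureRecovery.lean` (`α > 3/2` excluded outright): the ENDPOINT `α = N/2 = 3/2`
of D. Chae, R. Shvydkoy, *On formation of a locally self-similar collapse in the incompressible
Euler equations*, Arch. Ration. Mech. Anal. **209** (2013) 999–1017 = arXiv:1201.6009
[ChaeShvydkoy2013], **§3.1 "The energy conservative scaling `α = N/2`", Theorem 3.1** (held text,
p. 7):

> "Theorem 3.1. Let `v ∈ L²(ℝ^N) ∩ C¹_loc` and the pressure `q` given by (q). Suppose there exists
> a `δ > 0` and `C, c > 0` such that `c/|y|^{N+1−δ} ≤ |v(y)| ≤ C|y|^{1−δ}`, for all sufficiently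
> large `y`. Then `v = 0`."

and its printed proof: "Using that `α = N/2`, the factors in front of the energies disappear" in the
two-scale energy balance, "taking `l₁ = L = l₂/4`" gives
`∫_{L≤|y|≤2L}|v|² ≤ C∫_{L/2≤|y|≤4L}(|v|³ + |q||v|)/|y|` ((3.2)–(3.3)); the power spread and the
energy bound turn the cubic term into `L^{−δ}∫|v|²` ((tech10)); the pressure is split
`q = q₀ + q₁ + q₂ + q₃` (local part, `|z| ≤ L/4`, `L/4 ≤ |z| ≤ 8L`, `|z| ≥ 8L`) with
"`|q₁(y)| ≲ L^{−N}∫_{|z|≤L/4}|v|²`", "`∫|q₂|² ≲ ∫_{L/4≤|y|≤8L}|v|⁴`" (Calderón–Zygmund) and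
"`|q₃(y)| ≲ L^{−N}‖v‖₂²`", the lower bound being used as "`|v| = |v|²|v|⁻¹`"; whence
"`∫_{L≤|y|≤2L}|v|² ≤ (C/L^δ) Σ_{k=−2}^{3} ∫_{2^kL≤|y|≤2^{k+1}L}|v|²`" for large `L`, which iterated
`m` times gives `≲ C_m L^{−mδ}`, and "this immediately runs into contradiction with the lower bound".

## What is proved (all `theorem`s; `N = 3`)

* `IsSelfSimilarEulerProfile.shellEnergy_le_flux_three_halves` — (3.2)–(3.3) for every `C²` profile
  `(v, P)` at `α = 3/2`: `∫_{L≤|y|<2L}|v|² ≤ C L⁻¹ ∫_{L/2≤|y|<8L}(|v|³ + 2|P||v|)`, from the tree's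
  weighted two-scale identity `IsSelfSimilarEulerProfile.twoScale_energy_dyadic` (the shell is
  `{L/2 ≤ |y| < 8L}` rather than `{L/2 ≤ |y| ≤ 4L}` because of the tree's cut-offs).
* `shell_pressureVelocity_le_of_repr` — the pressure estimates on ONE dyadic shell
  `D = {ℓ<|y|<2ℓ}` for a field with the split Riesz representation `P = p̃[1_A v] + J₁ + J₃`
  (`A = {ℓ/2≤|z|<4ℓ}`; the tree's `BronziShvydkoy2015.exists_pressureProfile_shell_repr`, whose
  middle piece `p̃[1_A v]` is the printed `q₀ + q₂` and whose `J₁`, `J₃` are `q₁`, `q₃` at the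
  tree's radii `ℓ/2`, `4ℓ`): with `|v| ≤ m` on `A`, `|v| ≤ b|v|²` on `D` and Stein's bound at `p = 2`,
  `∫_D|P||v| ≤ (C₂m/2)(∫_D|v|² + ∫_A|v|²) + (4/(πℓ³)∫_{|z|<ℓ/2}|v|² + (4/π)∫_{|z|≥4ℓ}|v|²/|z|³) b ∫_D|v|²`.
* `IsSelfSimilarEulerProfile.eq_zero_of_powerSpread_of_shellRepr` — **Theorem 3.1 at the level of
  the profile**: a `C²` profile at `α = 3/2` with eventually bounded ball energies ("`v ∈ L²`"), the
  shell representation of its pressure ("`q` given by (q)") and the power spread is `0` (indeed the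
  hypotheses are contradictory).
* `IsSelfSimilarEulerProfile.eq_zero_of_memLp_two_of_powerSpread` — **Theorem 3.1 as printed**
  (profile level): `v ∈ L²(ℝ³)`, `P = p̃[v] + const` ("the pressure `q` given by (q)", the tree's
  `normalisedPressure`), power spread ⇒ `v = 0`; the shell representation is then a theorem
  (`BronziShvydkoy2015.normalisedPressure_eq_indicator_add`, principal values by
  `hasPressurePV_of_contDiff_holds`). `IsSelfSimilarEulerProfile.add_const`: `P ↦ P + κ` preserves
  the profile system.
* `eq_zero_of_locallySelfSimilar_energyConserving_of_powerSpread` — **Theorem 3.1 for the ambient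
  blow-up** in the class of the paper's §1–2 as rendered in the tree (Beale–Kato–Majda classical
  Euler solution on `ℝ³ × [0,T)`, exact ansatz `selfSimilarCollapse (2/5) T v` on `B_{ρ₀}(x₀)`,
  `v ∈ C²`): the profile data of §3 are DERIVED — bounded ball energies from the energy growth
  (1.6) `energyGrowth_of_locallySelfSimilar` at `α = 3/2`, the representation from
  `BronziShvydkoy2015.exists_pressureProfile_shell_repr` — and `v = 0`;
  `not_powerSpread_of_locallySelfSimilar_energyConserving` reads it as a non-existence statement.

Deviations from the printed text, all on the safe side: `C¹_loc` is strengthened to `C²` (the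
tree's profile notion `IsSelfSimilarEulerProfile` and pressure recovery); the numerical radii of the
pressure split are the tree's (`ℓ/2`, `4ℓ` per shell) and the flux shell is `{L/2≤|y|<8L}`, so the
iteration runs over the same six dyadic energies `Σ_{k=−2}^{3}`; `δ` is first normalised to
`δ' = min δ 1` on `|y| ≥ max R 1` (`powerSpread_normalise`). For the ns-blowup profile census (zone
literature Z5–Z8, hypothesised exactly self-similar EULER collapses read in the BKM class): at the
energy-conserving exponent `c_l = 2/5` a rescaled profile pinched between `c|y|^{−(4−δ)}` and
`C|y|^{1−δ}` far out is not a collapse profile. A rendering of the same theorem inside Seregin's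
suitable-weak class lives summit-side (`Summit.NavierStokesRegularity.…PowerGaugeEulerLiouville.
selfSimilar_half_false_of_powerSpread'`, route EulerZoomLiouville); Literature does not import
Summits, and the present file is the locally-self-similar/BKM statement of the paper on the tree's
Bronzi–Shvydkoy vocabulary. WHAT THIS IS NOT: not a statement about Navier–Stokes.

## Mathlib / tree search

`lean search 'powerSpread'`: only the summit-side weak-class files above; `'shellEnergy_le_flux'`,
`'shell_pressureVelocity'`: absent (2026-08-27). Reused: `IsSelfSimilarEulerProfile.twoScale_energy_dyadic`,
`ball_energy_le_twoScaleEnergy` (`SelfSimilarEulerEnergyLowerBound.lean`),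
`BronziShvydkoy2015.abs_integral_kernel_ball_le/_far_le`, `….exists_pressureProfile_shell_repr`
(`SelfSimilarEulerPressureShellBound.lean`), `BronziShvydkoy2015.farWeight_integrableOn_and_le`
(`SelfSimilarEulerEnergyBootstrap.lean`), `energyGrowth_of_locallySelfSimilar`
(`SelfSimilarEulerPressureRecovery.lean`), `memLp_normalisedPressure_of_sq`
(`NormalisedPressureLpClass.lean`), `stein1970_normalisedPressure_ae_Lp_bound_holds`
(`LocalLerayPressureDecompositionProofs.lean`); Mathlib `integral_mul_le_Lp_mul_Lq_of_nonneg`,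
`MemLp.eLpNorm_eq_integral_rpow_norm`, `Measure.addHaar_real_closedBall'`, `measureReal_sdiff`,
`Real.rpow_le_rpow_of_nonpos`, `Real.pi_gt_three`. No new definitions, no instances, no notation.

## References

* D. Chae, R. Shvydkoy, *On formation of a locally self-similar collapse in the incompressible Euler
  equations*, Arch. Ration. Mech. Anal. 209 (2013) 999–1017 = arXiv:1201.6009, §3.1 Thm. 3.1 and
  its proof ((3.2)–(3.3), (tech10), the estimates for `q₁`, `q₂`, `q₃`, the iteration). [ChaeShvydkoy2013]
* A. Bronzi, R. Shvydkoy, Indiana Univ. Math. J. 64 (2015) 1291–1302 = arXiv:1310.8611, §2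
  Lemma 2.1 (the pressure representation used here). [BronziShvydkoy2015]
* E. M. Stein, *Singular integrals and differentiability properties of functions* (1970), Ch. II
  (the `L²` bound for `p̃`). [Stein1970]
-/

noncomputable section

open MeasureTheory Set Filter Topology Metric
open scoped ENNReal NNReal

namespace Literature.Analysis.FluidPDE

/-! ## Tools: shells as differences of balls, shell integrals, the cut-off energy -/

/-- The half-open shell `{a ≤ |y| < b}` is the difference of two balls. [folklore] -/
private theorem shell_eq_ball_sdiff (a b : ℝ) :
    {y : EuclideanSpace ℝ (Fin 3) | a ≤ ‖y‖ ∧ ‖y‖ < b} =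
      ball (0 : EuclideanSpace ℝ (Fin 3)) b \ ball (0 : EuclideanSpace ℝ (Fin 3)) a := by
  ext y
  simp only [mem_setOf_eq, Set.mem_sdiff, mem_ball_zero_iff, not_lt]
  tauto

/-- A continuous function is integrable on every ball. [folklore] -/
private theorem integrableOn_ballZero_of_continuous {g : EuclideanSpace ℝ (Fin 3) → ℝ} (hg : Continuous g)
    (r : ℝ) : IntegrableOn g (ball (0 : EuclideanSpace ℝ (Fin 3)) r) volume :=
  (hg.continuousOn.integrableOn_compact (isCompact_closedBall 0 r)).mono_set ball_subset_closedBall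

/-- `∫_{a ≤ |y| < b} g = ∫_{|y|<b} g − ∫_{|y|<a} g` for `a ≤ b` and continuous `g`. [folklore] -/
private theorem setIntegral_shell_eq_sub {g : EuclideanSpace ℝ (Fin 3) → ℝ} (hg : Continuous g)
    {a b : ℝ} (hab : a ≤ b) :
    ∫ y in {y : EuclideanSpace ℝ (Fin 3) | a ≤ ‖y‖ ∧ ‖y‖ < b}, g y =
      (∫ y in ball (0 : EuclideanSpace ℝ (Fin 3)) b, g y) -
        ∫ y in ball (0 : EuclideanSpace ℝ (Fin 3)) a, g y := by
  rw [shell_eq_ball_sdiff]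
  exact setIntegral_sdiff measurableSet_ball (integrableOn_ballZero_of_continuous hg b)
    (ball_subset_ball hab)

/-- The half-open and the open shell carry the same integrals (the sphere `|y| = a` is
Lebesgue-null). [folklore] -/
private theorem setIntegral_shell_eq_open (g : EuclideanSpace ℝ (Fin 3) → ℝ) (a b : ℝ) :
    ∫ y in {y : EuclideanSpace ℝ (Fin 3) | a ≤ ‖y‖ ∧ ‖y‖ < b}, g y =
      ∫ y in {y : EuclideanSpace ℝ (Fin 3) | a < ‖y‖ ∧ ‖y‖ < b}, g y := by
  refine setIntegral_congr_set ?_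
  rw [ae_eq_set]
  constructor
  · refine measure_mono_null (fun y hy => ?_)
      (Measure.addHaar_sphere volume (0 : EuclideanSpace ℝ (Fin 3)) a)
    obtain ⟨⟨h1, h2⟩, hnot⟩ := hy
    simp only [mem_setOf_eq, not_and, not_lt] at hnot
    rw [mem_sphere_zero_iff_norm]
    by_contra hne
    have hlt : a < ‖y‖ := lt_of_le_of_ne h1 (Ne.symm hne)
    linarith [hnot hlt]
  · refine measure_mono_null (fun y hy => ?_) (measure_empty (μ := volume))
    obtain ⟨⟨h1, h2⟩, hnot⟩ := hy
    exact hnot ⟨h1.le, h2⟩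

/-- **The cut-off energy is dominated by the energy of the SAME ball**:
`∫ σ(2 − 2|y|²/λ²)|U|² ≤ ∫_{|y|<λ} |U|²` (`0 ≤ σ ≤ 1` and `σ(2 − 2|y|²/λ²) = 0` for `|y| ≥ λ`;
sharper form of `twoScaleEnergy_le_ball_energy`). [cite: ChaeShvydkoy2013, §2.2 eq. (2.9) (cut-off)] -/
private theorem twoScaleEnergy_le_ball_energy' {U : EuclideanSpace ℝ (Fin 3) → EuclideanSpace ℝ (Fin 3)}
    (hU : Continuous U) {lam : ℝ} (hlam : 0 < lam) :
    ∫ y, Real.smoothTransition (2 - 2 * (‖y‖ ^ 2 / lam ^ 2)) * ‖U y‖ ^ 2 ≤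
      ∫ y in ball (0 : EuclideanSpace ℝ (Fin 3)) lam, ‖U y‖ ^ 2 := by
  rw [← MeasureTheory.integral_indicator measurableSet_ball]
  have hint : Integrable ((ball (0 : EuclideanSpace ℝ (Fin 3)) lam).indicator
      fun y => ‖U y‖ ^ 2) volume :=
    (integrableOn_ballZero_of_continuous (hU.norm.pow 2) lam).integrable_indicator measurableSet_ball
  refine integral_mono_of_nonneg (Eventually.of_forall fun y =>
    mul_nonneg (Real.smoothTransition.nonneg _) (by positivity)) hint
    (Eventually.of_forall fun y => ?_)
  dsimp only
  by_cases hy : y ∈ ball (0 : EuclideanSpace ℝ (Fin 3)) lam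
  · rw [indicator_of_mem hy]
    exact mul_le_of_le_one_left (by positivity) (Real.smoothTransition.le_one _)
  · rw [indicator_of_notMem hy]
    rw [mem_ball, dist_zero_right, not_lt] at hy
    have h1 : 1 ≤ ‖y‖ ^ 2 / lam ^ 2 := by
      rw [le_div_iff₀ (by positivity), one_mul]
      exact pow_le_pow_left₀ hlam.le hy 2
    rw [Real.smoothTransition.zero_of_nonpos (by linarith), zero_mul]

/-! ## The weight-free two-scale step at `α = 3/2` (CS13 (3.2)–(3.3)) -/

/-- **Chae–Shvydkoy 2013, (3.2)–(3.3).** At the energy-conserving scaling `α = 3/2` (exponent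
`γ = 1/(α+1) = 2/5`) "the factors in front of the energies disappear" in the two-scale identity
(2.9), and "taking `l₁ = L = l₂/4`" the dyadic shell energy is bounded by the flux through the
shell `{L/2 ≤ |y| ≤ 4L}`: for every `C²` profile `(v, P)` there is `C ≥ 0` with
`∫_{L ≤ |y| < 2L} |v|² ≤ C L⁻¹ ∫_{L/2 ≤ |y| < 8L} (|v|³ + 2|P||v|)` for all `L > 0`.
[cite: ChaeShvydkoy2013, §3.1 eqs. (3.2)–(3.3)] -/
theorem IsSelfSimilarEulerProfile.shellEnergy_le_flux_three_halves
    {v : EuclideanSpace ℝ (Fin 3) → EuclideanSpace ℝ (Fin 3)} {P : EuclideanSpace ℝ (Fin 3) → ℝ}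
    (h : IsSelfSimilarEulerProfile (1 / ((3 / 2 : ℝ) + 1)) 0 v P) :
    ∃ C : ℝ, 0 ≤ C ∧ ∀ L : ℝ, 0 < L →
      ∫ y in {y : EuclideanSpace ℝ (Fin 3) | L ≤ ‖y‖ ∧ ‖y‖ < 2 * L}, ‖v y‖ ^ 2 ≤
        C * L⁻¹ * ∫ y in {y : EuclideanSpace ℝ (Fin 3) | L / 2 ≤ ‖y‖ ∧ ‖y‖ < 8 * L},
          (‖v y‖ ^ 3 + 2 * (|P y| * ‖v y‖)) := by
  have hvc : Continuous v := h.contDiff_velocity.continuous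
  have hPc : Continuous P := h.contDiff_pressure.continuous
  obtain ⟨C, hC0, hdy⟩ := h.twoScale_energy_dyadic (α := 3 / 2) (by norm_num)
  refine ⟨2 * C, by positivity, fun L hL => ?_⟩
  have hf0 : ∀ y : EuclideanSpace ℝ (Fin 3), 0 ≤ ‖v y‖ ^ 3 + 2 * (|P y| * ‖v y‖) := fun y => by
    positivity
  have hfc : Continuous fun y : EuclideanSpace ℝ (Fin 3) => ‖v y‖ ^ 3 + 2 * (|P y| * ‖v y‖) :=
    (hvc.norm.pow 3).add (continuous_const.mul ((continuous_abs.comp hPc).mul hvc.norm))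
  set T : Set (EuclideanSpace ℝ (Fin 3)) := {y | L / 2 ≤ ‖y‖ ∧ ‖y‖ < 8 * L} with hT_def
  have hTsub : T ⊆ closedBall (0 : EuclideanSpace ℝ (Fin 3)) (8 * L) := fun y hy => by
    rw [mem_closedBall_zero_iff]; exact hy.2.le
  have hfT : IntegrableOn (fun y : EuclideanSpace ℝ (Fin 3) => ‖v y‖ ^ 3 + 2 * (|P y| * ‖v y‖)) T
      volume :=
    (hfc.continuousOn.integrableOn_compact (isCompact_closedBall 0 (8 * L))).mono_set hTsub
  have hfT0 : 0 ≤ ∫ y in T, (‖v y‖ ^ 3 + 2 * (|P y| * ‖v y‖)) := integral_nonneg fun y => hf0 y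
  -- the two dyadic annuli of the identity sit inside `T`
  have hAsub : ∀ j : ℕ, j < 2 →
      {y : EuclideanSpace ℝ (Fin 3) | (2 ^ j * L) ^ 2 / 2 ≤ ‖y‖ ^ 2 ∧ ‖y‖ ^ 2 ≤ 4 * (2 ^ j * L) ^ 2} ⊆ T := by
    intro j hj y hy
    obtain ⟨h1, h2⟩ := hy
    have hy0 : 0 ≤ ‖y‖ := norm_nonneg _
    have h2j : (1 : ℝ) ≤ 2 ^ j := one_le_pow₀ (by norm_num)
    have h2j' : (2 : ℝ) ^ j ≤ 2 := by
      interval_cases j <;> norm_num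
    have hL2 : L ^ 2 ≤ (2 ^ j * L) ^ 2 :=
      pow_le_pow_left₀ hL.le (le_mul_of_one_le_left hL.le h2j) 2
    have hL3 : (2 ^ j * L) ^ 2 ≤ (2 * L) ^ 2 :=
      pow_le_pow_left₀ (by positivity) (mul_le_mul_of_nonneg_right h2j' hL.le) 2
    have hLL : 0 < L ^ 2 := by positivity
    constructor
    · by_contra hlt
      push Not at hlt
      have hsq : ‖y‖ ^ 2 < (L / 2) ^ 2 := pow_lt_pow_left₀ hlt hy0 two_ne_zero
      have e : (L / 2) ^ 2 = L ^ 2 / 4 := by ring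
      rw [e] at hsq
      linarith
    · by_contra hge
      push Not at hge
      have hsq : (8 * L) ^ 2 ≤ ‖y‖ ^ 2 := pow_le_pow_left₀ (by positivity) hge 2
      have e1 : (8 * L) ^ 2 = 64 * L ^ 2 := by ring
      have e2 : (2 * L) ^ 2 = 4 * L ^ 2 := by ring
      rw [e1] at hsq
      rw [e2] at hL3
      linarith
  have hterm : ∀ j ∈ Finset.range 2, (2 ^ j * L) ^ (2 * (3 / 2 : ℝ) - 4) *
      ∫ y in {y : EuclideanSpace ℝ (Fin 3) | (2 ^ j * L) ^ 2 / 2 ≤ ‖y‖ ^ 2 ∧ ‖y‖ ^ 2 ≤ 4 * (2 ^ j * L) ^ 2},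
        (‖v y‖ ^ 3 + 2 * (|P y| * ‖v y‖)) ≤
      L⁻¹ * ∫ y in T, (‖v y‖ ^ 3 + 2 * (|P y| * ‖v y‖)) := by
    intro j hj
    rw [Finset.mem_range] at hj
    have h2j : (1 : ℝ) ≤ 2 ^ j := one_le_pow₀ (by norm_num)
    have hjL : 0 < 2 ^ j * L := by positivity
    have hpow : (2 ^ j * L) ^ (2 * (3 / 2 : ℝ) - 4) ≤ L⁻¹ := by
      rw [show (2 : ℝ) * (3 / 2) - 4 = -1 by norm_num, Real.rpow_neg_one]
      exact inv_anti₀ hL (le_mul_of_one_le_left hL.le h2j)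
    have hint : ∫ y in {y : EuclideanSpace ℝ (Fin 3) | (2 ^ j * L) ^ 2 / 2 ≤ ‖y‖ ^ 2 ∧
        ‖y‖ ^ 2 ≤ 4 * (2 ^ j * L) ^ 2}, (‖v y‖ ^ 3 + 2 * (|P y| * ‖v y‖)) ≤
        ∫ y in T, (‖v y‖ ^ 3 + 2 * (|P y| * ‖v y‖)) :=
      setIntegral_mono_set hfT (ae_of_all _ hf0) (ae_of_all _ (hAsub j hj))
    have hint0 : 0 ≤ ∫ y in {y : EuclideanSpace ℝ (Fin 3) | (2 ^ j * L) ^ 2 / 2 ≤ ‖y‖ ^ 2 ∧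
        ‖y‖ ^ 2 ≤ 4 * (2 ^ j * L) ^ 2}, (‖v y‖ ^ 3 + 2 * (|P y| * ‖v y‖)) :=
      integral_nonneg fun y => hf0 y
    exact mul_le_mul hpow hint hint0 (by positivity)
  have hsum := Finset.sum_le_sum hterm
  rw [Finset.sum_const, Finset.card_range, nsmul_eq_mul, Nat.cast_ofNat] at hsum
  -- the identity between the scales `L` and `4L = 2² L`
  have hmain := hdy L hL 2
  rw [show (2 : ℝ) * (3 / 2) - 3 = 0 by norm_num, Real.rpow_zero, Real.rpow_zero, one_mul, one_mul,
    show (2 : ℝ) ^ (2 : ℕ) * L = 4 * L by norm_num] at hmain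
  -- the ball energies against the cut-off energies
  have hlow : ∫ y in ball (0 : EuclideanSpace ℝ (Fin 3)) (2 * L), ‖v y‖ ^ 2 ≤
      ∫ y, Real.smoothTransition (2 - 2 * (‖y‖ ^ 2 / (4 * L) ^ 2)) * ‖v y‖ ^ 2 := by
    have := ball_energy_le_twoScaleEnergy (α := 3 / 2) hvc (lam := 4 * L) (by positivity)
    rw [show (2 : ℝ) * (3 / 2) - 3 = 0 by norm_num, Real.rpow_zero, one_mul, one_mul,
      show 4 * L / 2 = 2 * L by ring] at this
    exact this
  have hup : ∫ y, Real.smoothTransition (2 - 2 * (‖y‖ ^ 2 / L ^ 2)) * ‖v y‖ ^ 2 ≤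
      ∫ y in ball (0 : EuclideanSpace ℝ (Fin 3)) L, ‖v y‖ ^ 2 := twoScaleEnergy_le_ball_energy' hvc hL
  rw [setIntegral_shell_eq_sub (g := fun y => ‖v y‖ ^ 2) (hvc.norm.pow 2) (by linarith : L ≤ 2 * L)]
  have habs := le_abs_self ((∫ y, Real.smoothTransition (2 - 2 * (‖y‖ ^ 2 / (4 * L) ^ 2)) * ‖v y‖ ^ 2) -
    ∫ y, Real.smoothTransition (2 - 2 * (‖y‖ ^ 2 / L ^ 2)) * ‖v y‖ ^ 2)
  calc (∫ y in ball (0 : EuclideanSpace ℝ (Fin 3)) (2 * L), ‖v y‖ ^ 2) -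
        ∫ y in ball (0 : EuclideanSpace ℝ (Fin 3)) L, ‖v y‖ ^ 2
      ≤ (∫ y, Real.smoothTransition (2 - 2 * (‖y‖ ^ 2 / (4 * L) ^ 2)) * ‖v y‖ ^ 2) -
          ∫ y, Real.smoothTransition (2 - 2 * (‖y‖ ^ 2 / L ^ 2)) * ‖v y‖ ^ 2 := by linarith
    _ ≤ C * (2 * (L⁻¹ * ∫ y in T, (‖v y‖ ^ 3 + 2 * (|P y| * ‖v y‖)))) :=
        habs.trans (hmain.trans (mul_le_mul_of_nonneg_left hsum hC0))
    _ = 2 * C * L⁻¹ * ∫ y in T, (‖v y‖ ^ 3 + 2 * (|P y| * ‖v y‖)) := by ring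

/-! ## Real form of the `L²` norm and Stein's bound at `p = 2` -/

/-- For a real function in `L²`, `‖f‖_{L²} = √(∫ f²)` (as an extended nonnegative real). [folklore] -/
private theorem eLpNorm_two_eq_ofReal_sqrt_real {f : EuclideanSpace ℝ (Fin 3) → ℝ} (hf : MemLp f 2 volume) :
    eLpNorm f 2 volume = ENNReal.ofReal (Real.sqrt (∫ x, f x ^ 2)) := by
  rw [hf.eLpNorm_eq_integral_rpow_norm two_ne_zero ENNReal.ofNat_ne_top]
  congr 1
  rw [Real.sqrt_eq_rpow, ENNReal.toReal_ofNat, one_div]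
  congr 1
  refine integral_congr_ae (Eventually.of_forall fun x => ?_)
  simp only [Real.norm_eq_abs, Real.rpow_two, sq_abs]

/-! ## CS13 §3.1: the pressure term on one dyadic shell (the pieces `q₀ + q₂`, `q₁`, `q₃`) -/

set_option maxHeartbeats 400000 in
/-- **Chae–Shvydkoy 2013, §3.1, the pressure estimates on one dyadic shell.** Let `v` be continuous,
`P` continuous with, on the shell `D = {ℓ < |y| < 2ℓ}`, the split representation
`P = p̃[1_A v] + J₁ + J₃` (`A = {ℓ/2 ≤ |z| < 4ℓ}`, `J₁ = ∫_{|z|<ℓ/2} K(·−z)(v z)`,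
`J₃ = ∫_{|z|≥4ℓ} K(·−z)(v z)`; the tree's `BronziShvydkoy2015.exists_pressureProfile_shell_repr`),
with the far weight `|v|²/|z|³` integrable on `{|z| ≥ 4ℓ}`, and suppose `|v| ≤ m` on `A` and
`|v| ≤ b|v|²` on `D` (the printed power spread gives `m = C(4ℓ)^{1−δ}`, `b = (2ℓ)^{N+1−δ}/c`). If
`‖p̃[w]‖₂ ≤ C₂ ‖|w|²‖₂` for measurable `w` with `|w|² ∈ L²` (Stein, `p = 2`), then
`∫_D |P||v| ≤ (C₂ m/2)(∫_D|v|² + ∫_A|v|²) + (4/(πℓ³)∫_{|z|<ℓ/2}|v|² + (4/π)∫_{|z|≥4ℓ}|v|²/|z|³) b ∫_D|v|²`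
— the printed bounds for `q₂` ("`∫|q₂|² ≲ ∫_{L/4≤|y|≤8L}|v|⁴`", Cauchy–Schwarz) and for `q₁`, `q₃`
("`|q₁(y)| ≲ L^{−N}∫_{|z|≤L/4}|v|²`", "`|q₃(y)| ≲ L^{−N}‖v‖₂²`", then `|v| = |v|²|v|⁻¹`).
[cite: ChaeShvydkoy2013, §3.1 (proof of Thm. 3.1, estimates for q₁, q₂, q₃)] -/
theorem shell_pressureVelocity_le_of_repr
    {v : EuclideanSpace ℝ (Fin 3) → EuclideanSpace ℝ (Fin 3)} {P : EuclideanSpace ℝ (Fin 3) → ℝ}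
    (hv : Continuous v) {ℓ : ℝ} (hℓ : 0 < ℓ) {C₂ : ℝ≥0}
    (hSt : ∀ w : EuclideanSpace ℝ (Fin 3) → EuclideanSpace ℝ (Fin 3), AEStronglyMeasurable w volume →
      MemLp (fun x => ‖w x‖ ^ 2) 2 volume →
        eLpNorm (normalisedPressure w) 2 volume ≤ C₂ * eLpNorm (fun x => ‖w x‖ ^ 2) 2 volume)
    (hrepr : ∀ y : EuclideanSpace ℝ (Fin 3), ℓ < ‖y‖ ∧ ‖y‖ < 2 * ℓ →
      P y = normalisedPressure
          ({z : EuclideanSpace ℝ (Fin 3) | ℓ / 2 ≤ ‖z‖ ∧ ‖z‖ < 4 * ℓ}.indicator v) y +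
        (∫ z in ball (0 : EuclideanSpace ℝ (Fin 3)) (ℓ / 2), pressureKernel (y - z) (v z)) +
        ∫ z in {z : EuclideanSpace ℝ (Fin 3) | 4 * ℓ ≤ ‖z‖}, pressureKernel (y - z) (v z))
    (hfar : IntegrableOn (fun z => ‖v z‖ ^ 2 / ‖z‖ ^ 3)
      {z : EuclideanSpace ℝ (Fin 3) | 4 * ℓ ≤ ‖z‖} volume)
    {m b : ℝ} (hm0 : 0 ≤ m)
    (hm : ∀ z : EuclideanSpace ℝ (Fin 3), ℓ / 2 ≤ ‖z‖ → ‖z‖ < 4 * ℓ → ‖v z‖ ≤ m)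
    (hb : ∀ y : EuclideanSpace ℝ (Fin 3), ℓ < ‖y‖ → ‖y‖ < 2 * ℓ → ‖v y‖ ≤ b * ‖v y‖ ^ 2) :
    ∫ y in {y : EuclideanSpace ℝ (Fin 3) | ℓ < ‖y‖ ∧ ‖y‖ < 2 * ℓ}, |P y| * ‖v y‖ ≤
      (C₂ : ℝ) * m / 2 * ((∫ y in {y : EuclideanSpace ℝ (Fin 3) | ℓ < ‖y‖ ∧ ‖y‖ < 2 * ℓ}, ‖v y‖ ^ 2) +
          ∫ z in {z : EuclideanSpace ℝ (Fin 3) | ℓ / 2 ≤ ‖z‖ ∧ ‖z‖ < 4 * ℓ}, ‖v z‖ ^ 2) +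
        (4 / (Real.pi * ℓ ^ 3) * (∫ z in ball (0 : EuclideanSpace ℝ (Fin 3)) (ℓ / 2), ‖v z‖ ^ 2) +
            4 / Real.pi * ∫ z in {z : EuclideanSpace ℝ (Fin 3) | 4 * ℓ ≤ ‖z‖}, ‖v z‖ ^ 2 / ‖z‖ ^ 3) *
          b * ∫ y in {y : EuclideanSpace ℝ (Fin 3) | ℓ < ‖y‖ ∧ ‖y‖ < 2 * ℓ}, ‖v y‖ ^ 2 := by
  set D : Set (EuclideanSpace ℝ (Fin 3)) := {y | ℓ < ‖y‖ ∧ ‖y‖ < 2 * ℓ} with hD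
  set A : Set (EuclideanSpace ℝ (Fin 3)) := {z | ℓ / 2 ≤ ‖z‖ ∧ ‖z‖ < 4 * ℓ} with hA
  set F : Set (EuclideanSpace ℝ (Fin 3)) := {z | 4 * ℓ ≤ ‖z‖} with hF
  have hDm : MeasurableSet D :=
    (isOpen_lt continuous_const continuous_norm).measurableSet.inter
      (isOpen_lt continuous_norm continuous_const).measurableSet
  have hAm : MeasurableSet A :=
    (isClosed_le continuous_const continuous_norm).measurableSet.inter
      (isOpen_lt continuous_norm continuous_const).measurableSet
  have hAbdd : Bornology.IsBounded A :=
    (isBounded_ball (x := (0 : EuclideanSpace ℝ (Fin 3))) (r := 4 * ℓ)).subset fun z hz => by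
      rw [mem_ball_zero_iff]; exact hz.2
  have hDbdd : Bornology.IsBounded D :=
    (isBounded_ball (x := (0 : EuclideanSpace ℝ (Fin 3))) (r := 2 * ℓ)).subset fun z hz => by
      rw [mem_ball_zero_iff]; exact hz.2
  have hDA : D ⊆ A := fun y hy => ⟨by linarith [hy.1], by linarith [hy.2]⟩
  haveI : IsFiniteMeasure (volume.restrict D) := isFiniteMeasure_restrict.2 hDbdd.measure_lt_top.ne
  -- the truncated field, its Stein bound in real form
  set w : EuclideanSpace ℝ (Fin 3) → EuclideanSpace ℝ (Fin 3) := A.indicator v with hw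
  have hwm : AEStronglyMeasurable w volume := hv.aestronglyMeasurable.indicator hAm
  have hw_sq : (fun x => ‖w x‖ ^ 2) = A.indicator (fun x => ‖v x‖ ^ 2) := by
    funext x
    by_cases hx : x ∈ A
    · rw [hw, indicator_of_mem hx, indicator_of_mem hx]
    · rw [hw, indicator_of_notMem hx, indicator_of_notMem hx, norm_zero, zero_pow two_ne_zero]
  have hw2 : MemLp (fun x => ‖w x‖ ^ 2) 2 volume := by
    rw [hw_sq, memLp_indicator_iff_restrict hAm]
    exact memLp_restrict_of_continuous_isBounded (hv.norm.pow 2) hAbdd _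
  have hg : MemLp (normalisedPressure w) 2 volume :=
    memLp_normalisedPressure_of_sq (p := 2) (by norm_num) ENNReal.ofNat_lt_top hwm hw2
  set Ip : ℝ := ∫ x, (normalisedPressure w x) ^ 2 with hIp
  set Iw : ℝ := ∫ x, (‖w x‖ ^ 2) ^ 2 with hIw
  have hIp0 : 0 ≤ Ip := integral_nonneg fun _ => sq_nonneg _
  have hIw0 : 0 ≤ Iw := integral_nonneg fun _ => sq_nonneg _
  have hStein : Real.sqrt Ip ≤ C₂ * Real.sqrt Iw := by
    have h1 := hSt w hwm hw2
    rw [eLpNorm_two_eq_ofReal_sqrt_real hg, eLpNorm_two_eq_ofReal_sqrt_real hw2, ← ENNReal.ofReal_coe_nnreal,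
      ← ENNReal.ofReal_mul NNReal.zero_le_coe] at h1
    exact (ENNReal.ofReal_le_ofReal_iff (by positivity)).1 h1
  -- `∫ (|w|²)² = ∫_A |v|⁴ ≤ m² ∫_A |v|²`
  have hIwle : Iw ≤ m ^ 2 * ∫ z in A, ‖v z‖ ^ 2 := by
    have e1 : Iw = ∫ z in A, (‖v z‖ ^ 2) ^ 2 := by
      rw [hIw, ← integral_indicator hAm]
      refine integral_congr_ae (Eventually.of_forall fun x => ?_)
      have hx2 : ‖w x‖ ^ 2 = A.indicator (fun x => ‖v x‖ ^ 2) x := congrFun hw_sq x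
      show (‖w x‖ ^ 2) ^ 2 = A.indicator (fun z => (‖v z‖ ^ 2) ^ 2) x
      rw [hx2]
      by_cases hx : x ∈ A
      · rw [indicator_of_mem hx, indicator_of_mem hx]
      · rw [indicator_of_notMem hx, indicator_of_notMem hx, zero_pow two_ne_zero]
    rw [e1, ← integral_const_mul]
    have hint4 : IntegrableOn (fun z => (‖v z‖ ^ 2) ^ 2) A volume :=
      memLp_one_iff_integrable.1 (memLp_restrict_of_continuous_isBounded ((hv.norm.pow 2).pow 2) hAbdd 1)
    have hint2 : IntegrableOn (fun z => m ^ 2 * ‖v z‖ ^ 2) A volume :=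
      (memLp_one_iff_integrable.1
        (memLp_restrict_of_continuous_isBounded (hv.norm.pow 2) hAbdd 1)).const_mul _
    refine setIntegral_mono_on hint4 hint2 hAm fun z hz => ?_
    have hvz := hm z hz.1 hz.2
    have h0 : 0 ≤ ‖v z‖ := norm_nonneg _
    have : ‖v z‖ ^ 2 ≤ m ^ 2 := pow_le_pow_left₀ h0 hvz 2
    nlinarith [sq_nonneg ‖v z‖]
  have hsqIw : Real.sqrt Iw ≤ m * Real.sqrt (∫ z in A, ‖v z‖ ^ 2) := by
    calc Real.sqrt Iw ≤ Real.sqrt (m ^ 2 * ∫ z in A, ‖v z‖ ^ 2) := Real.sqrt_le_sqrt hIwle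
      _ = m * Real.sqrt (∫ z in A, ‖v z‖ ^ 2) := by
          rw [Real.sqrt_mul (sq_nonneg _), Real.sqrt_sq hm0]
  -- Cauchy–Schwarz on the shell
  set SD : ℝ := ∫ y in D, ‖v y‖ ^ 2 with hSD
  set SA : ℝ := ∫ z in A, ‖v z‖ ^ 2 with hSA
  have hSD0 : 0 ≤ SD := integral_nonneg fun _ => sq_nonneg _
  have hSA0 : 0 ≤ SA := integral_nonneg fun _ => sq_nonneg _
  have hCS : ∫ y in D, |normalisedPressure w y| * ‖v y‖ ≤ Real.sqrt Ip * Real.sqrt SD := by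
    have hf : MemLp (fun y => |normalisedPressure w y|) (ENNReal.ofReal 2) (volume.restrict D) := by
      rw [ENNReal.ofReal_ofNat]
      exact (hg.restrict D).abs
    have hg' : MemLp (fun y => ‖v y‖) (ENNReal.ofReal 2) (volume.restrict D) := by
      rw [ENNReal.ofReal_ofNat]
      exact memLp_restrict_of_continuous_isBounded hv.norm hDbdd _
    have h := integral_mul_le_Lp_mul_Lq_of_nonneg (μ := volume.restrict D) Real.HolderConjugate.two_two
      (Eventually.of_forall fun y => abs_nonneg _) (Eventually.of_forall fun y => norm_nonneg _) hf hg'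
    simp only [Real.rpow_two, sq_abs] at h
    rw [← Real.sqrt_eq_rpow, ← Real.sqrt_eq_rpow] at h
    refine h.trans (mul_le_mul_of_nonneg_right ?_ (Real.sqrt_nonneg _))
    refine Real.sqrt_le_sqrt ?_
    rw [hIp]
    exact setIntegral_le_integral hg.integrable_sq (Eventually.of_forall fun _ => sq_nonneg _)
  -- the constant pieces `J₁`, `J₃`
  set M : ℝ := 4 / (Real.pi * ℓ ^ 3) * (∫ z in ball (0 : EuclideanSpace ℝ (Fin 3)) (ℓ / 2), ‖v z‖ ^ 2) +
    4 / Real.pi * ∫ z in F, ‖v z‖ ^ 2 / ‖z‖ ^ 3 with hM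
  have hM0 : 0 ≤ M := by
    have i1 : 0 ≤ ∫ z in ball (0 : EuclideanSpace ℝ (Fin 3)) (ℓ / 2), ‖v z‖ ^ 2 :=
      integral_nonneg fun _ => sq_nonneg _
    have i2 : 0 ≤ ∫ z in F, ‖v z‖ ^ 2 / ‖z‖ ^ 3 :=
      integral_nonneg fun _ => div_nonneg (sq_nonneg _) (pow_nonneg (norm_nonneg _) _)
    positivity
  have h1 : IntegrableOn (fun z => ‖v z‖ ^ 2) (ball (0 : EuclideanSpace ℝ (Fin 3)) (ℓ / 2)) volume :=
    integrableOn_ballZero_of_continuous (hv.norm.pow 2) _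
  have hpt : ∀ y ∈ D, |P y| * ‖v y‖ ≤ |normalisedPressure w y| * ‖v y‖ + M * b * ‖v y‖ ^ 2 := by
    intro y hy
    have hb1 := BronziShvydkoy2015.abs_integral_kernel_ball_le (w := v) hℓ hy.1 h1
    have hb3 := BronziShvydkoy2015.abs_integral_kernel_far_le (w := v) (by linarith : 0 < 4 * ℓ)
      (by linarith [hy.2]) hfar
    have hPle : |P y| ≤ |normalisedPressure w y| + M := by
      rw [hrepr y hy]
      calc |normalisedPressure w y +
              (∫ z in ball (0 : EuclideanSpace ℝ (Fin 3)) (ℓ / 2), pressureKernel (y - z) (v z)) +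
              ∫ z in F, pressureKernel (y - z) (v z)|
          ≤ |normalisedPressure w y| +
              |∫ z in ball (0 : EuclideanSpace ℝ (Fin 3)) (ℓ / 2), pressureKernel (y - z) (v z)| +
              |∫ z in F, pressureKernel (y - z) (v z)| := by
            exact (abs_add_le _ _).trans (add_le_add_left (abs_add_le _ _) _)
        _ ≤ |normalisedPressure w y| + M := by rw [hM]; linarith
    have hv0 : 0 ≤ ‖v y‖ := norm_nonneg _
    have hvb := hb y hy.1 hy.2
    calc |P y| * ‖v y‖ ≤ (|normalisedPressure w y| + M) * ‖v y‖ :=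
          mul_le_mul_of_nonneg_right hPle hv0
      _ = |normalisedPressure w y| * ‖v y‖ + M * ‖v y‖ := by ring
      _ ≤ |normalisedPressure w y| * ‖v y‖ + M * (b * ‖v y‖ ^ 2) :=
          add_le_add_right (mul_le_mul_of_nonneg_left hvb hM0) _
      _ = |normalisedPressure w y| * ‖v y‖ + M * b * ‖v y‖ ^ 2 := by ring
  -- integrate over the shell
  have ha : IntegrableOn (fun y => |normalisedPressure w y|) D volume :=
    ((hg.restrict D).abs).integrable one_le_two
  have hprod : IntegrableOn (fun y => |normalisedPressure w y| * ‖v y‖) D volume := by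
    have := Integrable.mul_bdd (μ := volume.restrict D) (c := m) ha
      hv.norm.aestronglyMeasurable.restrict ?_
    · exact this
    · rw [ae_restrict_iff' hDm]
      refine Eventually.of_forall fun y hy => ?_
      rw [Real.norm_eq_abs, abs_of_nonneg (norm_nonneg _)]
      exact hm y (hDA hy).1 (hDA hy).2
  have hsq : IntegrableOn (fun y => M * b * ‖v y‖ ^ 2) D volume :=
    (memLp_one_iff_integrable.1
      (memLp_restrict_of_continuous_isBounded (hv.norm.pow 2) hDbdd 1)).const_mul _
  have hint_rhs : IntegrableOn
      (fun y => |normalisedPressure w y| * ‖v y‖ + M * b * ‖v y‖ ^ 2) D volume := hprod.add hsq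
  have hstep1 : ∫ y in D, |P y| * ‖v y‖ ≤
      ∫ y in D, (|normalisedPressure w y| * ‖v y‖ + M * b * ‖v y‖ ^ 2) := by
    refine integral_mono_of_nonneg ?_ hint_rhs ?_
    · exact Eventually.of_forall fun y => mul_nonneg (abs_nonneg _) (norm_nonneg _)
    · rw [EventuallyLE, ae_restrict_iff' hDm]
      exact Eventually.of_forall hpt
  have hsplit : ∫ y in D, (|normalisedPressure w y| * ‖v y‖ + M * b * ‖v y‖ ^ 2) =
      (∫ y in D, |normalisedPressure w y| * ‖v y‖) + M * b * SD := by
    rw [integral_add hprod hsq, integral_const_mul]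
  have hamgm : Real.sqrt SA * Real.sqrt SD ≤ (SD + SA) / 2 := by
    nlinarith [sq_nonneg (Real.sqrt SA - Real.sqrt SD), Real.sq_sqrt hSA0, Real.sq_sqrt hSD0]
  have hC₂ : 0 ≤ (C₂ : ℝ) := NNReal.zero_le_coe
  calc ∫ y in D, |P y| * ‖v y‖
      ≤ (∫ y in D, |normalisedPressure w y| * ‖v y‖) + M * b * SD := hstep1.trans_eq hsplit
    _ ≤ Real.sqrt Ip * Real.sqrt SD + M * b * SD := by linarith [hCS]
    _ ≤ (C₂ * (m * Real.sqrt SA)) * Real.sqrt SD + M * b * SD :=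
        add_le_add_left (mul_le_mul_of_nonneg_right
          (hStein.trans (mul_le_mul_of_nonneg_left hsqIw hC₂)) (Real.sqrt_nonneg _)) _
    _ = C₂ * m * (Real.sqrt SA * Real.sqrt SD) + M * b * SD := by ring
    _ ≤ C₂ * m * ((SD + SA) / 2) + M * b * SD :=
        add_le_add_left (mul_le_mul_of_nonneg_left hamgm (mul_nonneg hC₂ hm0)) _
    _ = C₂ * m / 2 * (SD + SA) + M * b * SD := by ring

/-! ## CS13 §3.1: normalising the power spread, the iteration, the lower bound -/

/-- Normalisation of the power spread: one may take `δ ≤ 1`, the threshold radius `≥ max(R,1)`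
and `C ≥ 0`, with the bounds in the monomial forms `|v(y)| ≤ C|y|·|y|^{−δ}`,
`c|y|^{δ}/|y|⁴ ≤ |v(y)|`. [folklore] -/
private theorem powerSpread_normalise
    {v : EuclideanSpace ℝ (Fin 3) → EuclideanSpace ℝ (Fin 3)} {δ R C c : ℝ} (hδ : 0 < δ) (hc : 0 ≤ c)
    (hup : ∀ y, R ≤ ‖y‖ → ‖v y‖ ≤ C * ‖y‖ ^ (1 - δ))
    (hlow : ∀ y, R ≤ ‖y‖ → c * ‖y‖ ^ (-(4 - δ)) ≤ ‖v y‖) :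
    ∃ δ' R' C' : ℝ, 0 < δ' ∧ δ' ≤ 1 ∧ 1 ≤ R' ∧ 0 ≤ C' ∧
      (∀ y, R' ≤ ‖y‖ → ‖v y‖ ≤ C' * ‖y‖ * ‖y‖ ^ (-δ')) ∧
      (∀ y, R' ≤ ‖y‖ → c * ‖y‖ ^ δ' / ‖y‖ ^ 4 ≤ ‖v y‖) := by
  refine ⟨min δ 1, max R 1, max C 0, lt_min hδ one_pos, min_le_right _ _, le_max_right _ _,
    le_max_right _ _, fun y hy => ?_, fun y hy => ?_⟩
  · have hy1 : 1 ≤ ‖y‖ := (le_max_right _ _).trans hy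
    have hy0 : 0 < ‖y‖ := one_pos.trans_le hy1
    have h1 : ‖v y‖ ≤ max C 0 * ‖y‖ ^ (1 - δ) :=
      (hup y ((le_max_left _ _).trans hy)).trans
        (mul_le_mul_of_nonneg_right (le_max_left _ _) (Real.rpow_nonneg hy0.le _))
    have h2 : ‖y‖ ^ (1 - δ) ≤ ‖y‖ ^ (1 - min δ 1) :=
      Real.rpow_le_rpow_of_exponent_le hy1 (by linarith [min_le_left δ 1])
    have h3 : ‖y‖ ^ (1 - min δ 1) = ‖y‖ * ‖y‖ ^ (-min δ 1) := by
      rw [sub_eq_add_neg, Real.rpow_add hy0, Real.rpow_one]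
    calc ‖v y‖ ≤ max C 0 * ‖y‖ ^ (1 - δ) := h1
      _ ≤ max C 0 * ‖y‖ ^ (1 - min δ 1) := mul_le_mul_of_nonneg_left h2 (le_max_right _ _)
      _ = max C 0 * ‖y‖ * ‖y‖ ^ (-min δ 1) := by rw [h3, mul_assoc]
  · have hy1 : 1 ≤ ‖y‖ := (le_max_right _ _).trans hy
    have hy0 : 0 < ‖y‖ := one_pos.trans_le hy1
    have h1 : ‖y‖ ^ min δ 1 / ‖y‖ ^ 4 = ‖y‖ ^ (min δ 1 - 4) := by
      rw [Real.rpow_sub hy0]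
      norm_cast
    have h2 : ‖y‖ ^ (min δ 1 - 4) ≤ ‖y‖ ^ (-(4 - δ)) :=
      Real.rpow_le_rpow_of_exponent_le hy1 (by linarith [min_le_left δ 1])
    calc c * ‖y‖ ^ min δ 1 / ‖y‖ ^ 4 = c * ‖y‖ ^ (min δ 1 - 4) := by rw [mul_div_assoc, h1]
      _ ≤ c * ‖y‖ ^ (-(4 - δ)) := mul_le_mul_of_nonneg_left h2 hc
      _ ≤ ‖v y‖ := hlow y ((le_max_left _ _).trans hy)

/-- **CS13 §3.1, the iteration** ("let us now iterate the estimate above `m` times applying it to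
each integral in the sum … `≲ C_m / L^{mδ}`"): a non-negative bounded dyadic-shell function with
`S(L) ≤ K L^{−δ} Σ_{k=−2}^{3} S(2^k L)` for `L ≥ L₀` decays faster than every power.
[cite: ChaeShvydkoy2013, §3.1 (proof of Thm. 3.1, the claim)] -/
private theorem iterate_shellDecay {S : ℝ → ℝ} {K L₀ δ B : ℝ} (hδ : 0 ≤ δ) (hK : 0 ≤ K)
    (hL₀ : 0 < L₀) (hB : 0 ≤ B) (hSB : ∀ ℓ, 0 < ℓ → S ℓ ≤ B)
    (hstep : ∀ L, L₀ ≤ L → S L ≤ K * L ^ (-δ) *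
      (S (L / 4) + S (L / 2) + S L + S (2 * L) + S (4 * L) + S (8 * L))) :
    ∀ m : ℕ, ∃ Bm : ℝ, 0 ≤ Bm ∧ ∀ L, 4 ^ m * L₀ ≤ L → S L ≤ Bm * L ^ (-(m * δ)) := by
  intro m
  induction m with
  | zero =>
      refine ⟨B, hB, fun L hL => ?_⟩
      rw [pow_zero, one_mul] at hL
      rw [Nat.cast_zero, zero_mul, neg_zero, Real.rpow_zero, mul_one]
      exact hSB L (hL₀.trans_le hL)
  | succ m ih =>
      obtain ⟨Bm, hBm0, hBm⟩ := ih
      have h4z : 0 < (4 : ℝ) ^ (-(m * δ)) := Real.rpow_pos_of_pos (by norm_num) _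
      refine ⟨6 * K * Bm / (4 : ℝ) ^ (-(m * δ)), by positivity, fun L hL => ?_⟩
      have h41 : (1 : ℝ) ≤ 4 ^ (m + 1) := one_le_pow₀ (by norm_num)
      have hLL₀ : L₀ ≤ L := le_trans (le_mul_of_one_le_left hL₀.le h41) hL
      have hL0 : 0 < L := hL₀.trans_le hLL₀
      have hq : 4 ^ m * L₀ ≤ L / 4 := by
        rw [le_div_iff₀ (by norm_num : (0 : ℝ) < 4)]
        calc 4 ^ m * L₀ * 4 = 4 ^ (m + 1) * L₀ := by ring
          _ ≤ L := hL
      have hmδ : -((m : ℝ) * δ) ≤ 0 := by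
        have : (0 : ℝ) ≤ m * δ := mul_nonneg (Nat.cast_nonneg _) hδ
        linarith
      -- each of the six scales `2^k L`, `k = −2, …, 3`, is `≥ L/4 ≥ 4^m L₀`
      have hsc : ∀ x, L / 4 ≤ x → S x ≤ Bm * (L ^ (-((m : ℝ) * δ)) / 4 ^ (-((m : ℝ) * δ))) := by
        intro x hx
        have hx0 : 0 < L / 4 := by positivity
        refine (hBm x (hq.trans hx)).trans (mul_le_mul_of_nonneg_left ?_ hBm0)
        rw [← Real.div_rpow hL0.le (by norm_num : (0 : ℝ) ≤ 4)]
        exact Real.rpow_le_rpow_of_nonpos hx0 hx hmδ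
      have e1 := hsc (L / 4) le_rfl
      have e2 := hsc (L / 2) (by linarith)
      have e3 := hsc L (by linarith)
      have e4 := hsc (2 * L) (by linarith)
      have e5 := hsc (4 * L) (by linarith)
      have e6 := hsc (8 * L) (by linarith)
      have hsum : S (L / 4) + S (L / 2) + S L + S (2 * L) + S (4 * L) + S (8 * L) ≤
          6 * (Bm * (L ^ (-((m : ℝ) * δ)) / 4 ^ (-((m : ℝ) * δ)))) := by linarith
      have hKL : 0 ≤ K * L ^ (-δ) := mul_nonneg hK (Real.rpow_nonneg hL0.le _)
      calc S L ≤ K * L ^ (-δ) * (S (L / 4) + S (L / 2) + S L + S (2 * L) + S (4 * L) + S (8 * L)) :=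
            hstep L hLL₀
        _ ≤ K * L ^ (-δ) * (6 * (Bm * (L ^ (-((m : ℝ) * δ)) / 4 ^ (-((m : ℝ) * δ))))) :=
            mul_le_mul_of_nonneg_left hsum hKL
        _ = 6 * K * Bm / 4 ^ (-((m : ℝ) * δ)) * (L ^ (-δ) * L ^ (-((m : ℝ) * δ))) := by ring
        _ = 6 * K * Bm / 4 ^ (-((m : ℝ) * δ)) * L ^ (-(((m + 1 : ℕ) : ℝ) * δ)) := by
            rw [← Real.rpow_add hL0, Nat.cast_succ,
              show -δ + -((m : ℝ) * δ) = -(((m : ℝ) + 1) * δ) by ring]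

/-- The dyadic shell `{L ≤ |y| < 2L}` has volume `7 v₁ L³`, `v₁ = |B̄₁|`. [folklore] -/
private theorem measureReal_shell_eq {L : ℝ} (hL : 0 < L) :
    (volume : Measure (EuclideanSpace ℝ (Fin 3))).real
        {y : EuclideanSpace ℝ (Fin 3) | L ≤ ‖y‖ ∧ ‖y‖ < 2 * L} =
      7 * (volume : Measure (EuclideanSpace ℝ (Fin 3))).real
        (closedBall (0 : EuclideanSpace ℝ (Fin 3)) 1) * L ^ 3 := by
  have hset : {y : EuclideanSpace ℝ (Fin 3) | L ≤ ‖y‖ ∧ ‖y‖ < 2 * L} =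
      ball (0 : EuclideanSpace ℝ (Fin 3)) (2 * L) \ ball (0 : EuclideanSpace ℝ (Fin 3)) L := by
    ext y
    simp only [mem_setOf_eq, Set.mem_sdiff, mem_ball_zero_iff, not_lt]
    tauto
  rw [hset, measureReal_sdiff (ball_subset_ball (by linarith)) measurableSet_ball,
    ← Measure.addHaar_real_closedBall_eq_addHaar_real_ball,
    ← Measure.addHaar_real_closedBall_eq_addHaar_real_ball,
    Measure.addHaar_real_closedBall' volume (0 : EuclideanSpace ℝ (Fin 3)) (by linarith : (0:ℝ) ≤ 2 * L),
    Measure.addHaar_real_closedBall' volume (0 : EuclideanSpace ℝ (Fin 3)) hL.le,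
    finrank_euclideanSpace_fin]
  ring

/-- **The lower power bound integrated over a dyadic shell**: if `c|y|^{δ}/|y|⁴ ≤ |v(y)|` for
`|y| ≥ R'` (`R' ≥ 1`, `c ≥ 0`, `δ ≥ 0`), then `∫_{L ≤ |y| < 2L} |v|² ≥ (7 v₁ c²/256) / L⁵` for
`L ≥ R'`. [folklore] -/
private theorem shellEnergy_lower_bound
    {v : EuclideanSpace ℝ (Fin 3) → EuclideanSpace ℝ (Fin 3)} (hv : Continuous v) {δ R' c L : ℝ}
    (hδ : 0 ≤ δ) (hc : 0 ≤ c) (hR' : 1 ≤ R') (hL : R' ≤ L)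
    (hlow : ∀ y, R' ≤ ‖y‖ → c * ‖y‖ ^ δ / ‖y‖ ^ 4 ≤ ‖v y‖) :
    7 * (volume : Measure (EuclideanSpace ℝ (Fin 3))).real
        (closedBall (0 : EuclideanSpace ℝ (Fin 3)) 1) * c ^ 2 / (256 * L ^ 5) ≤
      ∫ y in {y : EuclideanSpace ℝ (Fin 3) | L ≤ ‖y‖ ∧ ‖y‖ < 2 * L}, ‖v y‖ ^ 2 := by
  have hL0 : 0 < L := one_pos.trans_le (hR'.trans hL)
  set D : Set (EuclideanSpace ℝ (Fin 3)) := {y | L ≤ ‖y‖ ∧ ‖y‖ < 2 * L} with hD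
  have hDm : MeasurableSet D :=
    (isClosed_le continuous_const continuous_norm).measurableSet.inter
      (isOpen_lt continuous_norm continuous_const).measurableSet
  have hDbdd : Bornology.IsBounded D :=
    (isBounded_ball (x := (0 : EuclideanSpace ℝ (Fin 3))) (r := 2 * L)).subset fun z hz => by
      rw [mem_ball_zero_iff]; exact hz.2
  haveI : IsFiniteMeasure (volume.restrict D) := isFiniteMeasure_restrict.2 hDbdd.measure_lt_top.ne
  -- pointwise: `|v(y)|² ≥ c²/(256 L⁸)` on the shell
  have hpt : ∀ y ∈ D, c ^ 2 / (256 * L ^ 8) ≤ ‖v y‖ ^ 2 := by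
    intro y hy
    have hy1 : 1 ≤ ‖y‖ := hR'.trans (hL.trans hy.1)
    have hy0 : 0 < ‖y‖ := one_pos.trans_le hy1
    have h1 : (1 : ℝ) ≤ ‖y‖ ^ δ := Real.one_le_rpow hy1 hδ
    have h2 : ‖y‖ ^ 4 ≤ 16 * L ^ 4 := by
      have : ‖y‖ ^ 4 ≤ (2 * L) ^ 4 := pow_le_pow_left₀ hy0.le hy.2.le 4
      linarith [this]
    have h3 : c / (16 * L ^ 4) ≤ ‖v y‖ := by
      refine le_trans ?_ (hlow y (hL.trans hy.1))
      rw [mul_div_assoc]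
      calc c / (16 * L ^ 4) = c * (1 / (16 * L ^ 4)) := by ring
        _ ≤ c * (‖y‖ ^ δ / ‖y‖ ^ 4) :=
            mul_le_mul_of_nonneg_left (div_le_div₀ (by positivity) h1 (by positivity) h2) hc
    have h4 : 0 ≤ c / (16 * L ^ 4) := by positivity
    calc c ^ 2 / (256 * L ^ 8) = (c / (16 * L ^ 4)) ^ 2 := by field_simp; ring
      _ ≤ ‖v y‖ ^ 2 := pow_le_pow_left₀ h4 h3 2
  have hint : IntegrableOn (fun y => ‖v y‖ ^ 2) D volume :=
    memLp_one_iff_integrable.1 (memLp_restrict_of_continuous_isBounded (hv.norm.pow 2) hDbdd 1)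
  calc 7 * (volume : Measure (EuclideanSpace ℝ (Fin 3))).real (closedBall (0 : EuclideanSpace ℝ (Fin 3)) 1) *
          c ^ 2 / (256 * L ^ 5)
      = c ^ 2 / (256 * L ^ 8) * (volume : Measure (EuclideanSpace ℝ (Fin 3))).real D := by
        rw [hD, measureReal_shell_eq hL0]
        field_simp
    _ = ∫ y in D, c ^ 2 / (256 * L ^ 8) := by
        rw [setIntegral_const, smul_eq_mul, mul_comm]
    _ ≤ ∫ y in D, ‖v y‖ ^ 2 :=
        setIntegral_mono_on (integrable_const _) hint hDm hpt

/-- Eventually bounded ball energies of a continuous field are bounded at every radius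
(monotonicity in the radius). [folklore] -/
private theorem ballEnergy_le_of_eventually
    {v : EuclideanSpace ℝ (Fin 3) → EuclideanSpace ℝ (Fin 3)} (hv : Continuous v) {C_E L_E : ℝ}
    (hE : ∀ L, L_E ≤ L → ∫ y in ball (0 : EuclideanSpace ℝ (Fin 3)) L, ‖v y‖ ^ 2 ≤ C_E) (r : ℝ) :
    ∫ y in ball (0 : EuclideanSpace ℝ (Fin 3)) r, ‖v y‖ ^ 2 ≤ C_E := by
  by_cases hr : L_E ≤ r
  · exact hE r hr
  · refine le_trans (setIntegral_mono_set ?_ (ae_of_all _ fun _ => sq_nonneg _)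
      (ae_of_all _ (ball_subset_ball (not_le.1 hr).le))) (hE L_E le_rfl)
    exact ((hv.norm.pow 2).continuousOn.integrableOn_compact (isCompact_closedBall 0 L_E)).mono_set
      ball_subset_closedBall

/-- The ball energy is monotone in the radius. [folklore] -/
private theorem ballEnergy_mono
    {v : EuclideanSpace ℝ (Fin 3) → EuclideanSpace ℝ (Fin 3)} (hv : Continuous v) {r s : ℝ} (hrs : r ≤ s) :
    ∫ y in ball (0 : EuclideanSpace ℝ (Fin 3)) r, ‖v y‖ ^ 2 ≤
      ∫ y in ball (0 : EuclideanSpace ℝ (Fin 3)) s, ‖v y‖ ^ 2 :=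
  setIntegral_mono_set
    (((hv.norm.pow 2).continuousOn.integrableOn_compact (isCompact_closedBall 0 s)).mono_set
      ball_subset_closedBall)
    (ae_of_all _ fun _ => sq_nonneg _) (ae_of_all _ (ball_subset_ball hrs))

/-- The upper power bound on the band `{L/4 ≤ |y| ≤ 16L}`, `L ≥ 4R'`:
`|v(y)| ≤ 64 C' L · L^{−δ}`. [folklore] -/
private theorem norm_le_of_upperPower_band
    {v : EuclideanSpace ℝ (Fin 3) → EuclideanSpace ℝ (Fin 3)} {δ R' C' L : ℝ} (hδ : 0 ≤ δ)
    (hδ1 : δ ≤ 1) (hR' : 1 ≤ R') (hC' : 0 ≤ C')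
    (hup : ∀ y, R' ≤ ‖y‖ → ‖v y‖ ≤ C' * ‖y‖ * ‖y‖ ^ (-δ)) (hL : 4 * R' ≤ L)
    {y : EuclideanSpace ℝ (Fin 3)} (hy1 : L / 4 ≤ ‖y‖) (hy2 : ‖y‖ ≤ 16 * L) :
    ‖v y‖ ≤ 64 * C' * L * L ^ (-δ) := by
  have hL0 : 0 < L := by linarith
  have hyR : R' ≤ ‖y‖ := by linarith
  have hy0 : 0 < ‖y‖ := by linarith
  have h1 : ‖y‖ ^ (-δ) ≤ (L / 4) ^ (-δ) :=
    Real.rpow_le_rpow_of_nonpos (by positivity) hy1 (by linarith)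
  have h2 : (L / 4) ^ (-δ) ≤ 4 * L ^ (-δ) := by
    rw [Real.div_rpow hL0.le (by norm_num : (0 : ℝ) ≤ 4)]
    have h4 : (4 : ℝ)⁻¹ ≤ 4 ^ (-δ) := by
      have := Real.rpow_le_rpow_of_exponent_le (by norm_num : (1 : ℝ) ≤ 4) (by linarith : (-1 : ℝ) ≤ -δ)
      rwa [Real.rpow_neg_one] at this
    calc L ^ (-δ) / 4 ^ (-δ) ≤ L ^ (-δ) / 4⁻¹ :=
          div_le_div_of_nonneg_left (Real.rpow_nonneg hL0.le _) (by norm_num) h4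
      _ = 4 * L ^ (-δ) := by ring
  calc ‖v y‖ ≤ C' * ‖y‖ * ‖y‖ ^ (-δ) := hup y hyR
    _ ≤ C' * (16 * L) * (4 * L ^ (-δ)) :=
        mul_le_mul (mul_le_mul_of_nonneg_left hy2 hC') (h1.trans h2) (Real.rpow_nonneg hy0.le _)
          (by positivity)
    _ = 64 * C' * L * L ^ (-δ) := by ring

/-- The lower power bound on the band `{L/4 ≤ |y| ≤ 16L}`, `L ≥ 4R'`, in the form used for the
pressure pieces `q₁`, `q₃` ("`|v| = |v|²|v|⁻¹`"): `|v(y)| ≤ (4·16⁴ L⁴ L^{−δ}/c) |v(y)|²`. [folklore] -/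
private theorem norm_le_mul_sq_of_lowerPower_band
    {v : EuclideanSpace ℝ (Fin 3) → EuclideanSpace ℝ (Fin 3)} {δ R' c L : ℝ} (hδ : 0 ≤ δ)
    (hδ1 : δ ≤ 1) (hR' : 1 ≤ R') (hc : 0 < c)
    (hlow : ∀ y, R' ≤ ‖y‖ → c * ‖y‖ ^ δ / ‖y‖ ^ 4 ≤ ‖v y‖) (hL : 4 * R' ≤ L)
    {y : EuclideanSpace ℝ (Fin 3)} (hy1 : L / 4 ≤ ‖y‖) (hy2 : ‖y‖ ≤ 16 * L) :
    ‖v y‖ ≤ 4 * 16 ^ 4 * L ^ 4 * L ^ (-δ) / c * ‖v y‖ ^ 2 := by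
  have hL0 : 0 < L := by linarith
  have hyR : R' ≤ ‖y‖ := by linarith
  have hy0 : 0 < ‖y‖ := by linarith
  have hLδ : 0 < L ^ δ := Real.rpow_pos_of_pos hL0 δ
  have h1 : (L / 4) ^ δ ≤ ‖y‖ ^ δ := Real.rpow_le_rpow (by positivity) hy1 hδ
  have h2 : L ^ δ / 4 ≤ (L / 4) ^ δ := by
    rw [Real.div_rpow hL0.le (by norm_num : (0 : ℝ) ≤ 4)]
    have h4 : (4 : ℝ) ^ δ ≤ 4 := by
      have := Real.rpow_le_rpow_of_exponent_le (by norm_num : (1 : ℝ) ≤ 4) hδ1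
      rwa [Real.rpow_one] at this
    exact div_le_div_of_nonneg_left hLδ.le (Real.rpow_pos_of_pos (by norm_num) _) h4
  have h3 : ‖y‖ ^ 4 ≤ (16 * L) ^ 4 := pow_le_pow_left₀ hy0.le hy2 4
  have hβ : c * (L ^ δ / 4) / (16 * L) ^ 4 ≤ ‖v y‖ := by
    refine le_trans ?_ (hlow y hyR)
    rw [mul_div_assoc, mul_div_assoc]
    refine mul_le_mul_of_nonneg_left ?_ hc.le
    exact div_le_div₀ (Real.rpow_nonneg hy0.le _) (h2.trans h1) (by positivity) h3
  have ht : L ^ (-δ) = (L ^ δ)⁻¹ := Real.rpow_neg hL0.le δ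
  have hone : 1 ≤ 4 * 16 ^ 4 * L ^ 4 * L ^ (-δ) / c * ‖v y‖ := by
    have hcoef : 0 ≤ 4 * 16 ^ 4 * L ^ 4 * L ^ (-δ) / c := by rw [ht]; positivity
    calc (1 : ℝ) = 4 * 16 ^ 4 * L ^ 4 * L ^ (-δ) / c * (c * (L ^ δ / 4) / (16 * L) ^ 4) := by
          rw [ht]; field_simp
      _ ≤ 4 * 16 ^ 4 * L ^ 4 * L ^ (-δ) / c * ‖v y‖ := mul_le_mul_of_nonneg_left hβ hcoef
  calc ‖v y‖ = ‖v y‖ * 1 := (mul_one _).symm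
    _ ≤ ‖v y‖ * (4 * 16 ^ 4 * L ^ 4 * L ^ (-δ) / c * ‖v y‖) :=
        mul_le_mul_of_nonneg_left hone (norm_nonneg _)
    _ = 4 * 16 ^ 4 * L ^ 4 * L ^ (-δ) / c * ‖v y‖ ^ 2 := by ring

/-- Splitting the flux through `T = {L/2 ≤ |y| < 8L}`: the cubic term against `sup_T |v| ≤ m`, the
pressure term over the four dyadic shells of `T`. [folklore] -/
private theorem flux_split
    {v : EuclideanSpace ℝ (Fin 3) → EuclideanSpace ℝ (Fin 3)} {P : EuclideanSpace ℝ (Fin 3) → ℝ}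
    (hv : Continuous v) (hPc : Continuous P) {L m : ℝ} (hL : 0 < L)
    (hm : ∀ y : EuclideanSpace ℝ (Fin 3), L / 4 ≤ ‖y‖ → ‖y‖ ≤ 16 * L → ‖v y‖ ≤ m) :
    ∫ y in {y : EuclideanSpace ℝ (Fin 3) | L / 2 ≤ ‖y‖ ∧ ‖y‖ < 8 * L}, (‖v y‖ ^ 3 + 2 * (|P y| * ‖v y‖)) ≤
      m * ((∫ y in ball (0 : EuclideanSpace ℝ (Fin 3)) (8 * L), ‖v y‖ ^ 2) -
            ∫ y in ball (0 : EuclideanSpace ℝ (Fin 3)) (L / 2), ‖v y‖ ^ 2) +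
        2 * ((∫ y in {y : EuclideanSpace ℝ (Fin 3) | L / 2 < ‖y‖ ∧ ‖y‖ < 2 * (L / 2)}, |P y| * ‖v y‖) +
            (∫ y in {y : EuclideanSpace ℝ (Fin 3) | L < ‖y‖ ∧ ‖y‖ < 2 * L}, |P y| * ‖v y‖) +
            (∫ y in {y : EuclideanSpace ℝ (Fin 3) | 2 * L < ‖y‖ ∧ ‖y‖ < 2 * (2 * L)}, |P y| * ‖v y‖) +
            ∫ y in {y : EuclideanSpace ℝ (Fin 3) | 4 * L < ‖y‖ ∧ ‖y‖ < 2 * (4 * L)}, |P y| * ‖v y‖) := by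
  set T : Set (EuclideanSpace ℝ (Fin 3)) := {y | L / 2 ≤ ‖y‖ ∧ ‖y‖ < 8 * L} with hT
  have hTm : MeasurableSet T :=
    (isClosed_le continuous_const continuous_norm).measurableSet.inter
      (isOpen_lt continuous_norm continuous_const).measurableSet
  have hTsub : T ⊆ closedBall (0 : EuclideanSpace ℝ (Fin 3)) (8 * L) := fun y hy => by
    rw [mem_closedBall_zero_iff]; exact hy.2.le
  have hgc : Continuous fun y => |P y| * ‖v y‖ := (continuous_abs.comp hPc).mul hv.norm
  have hf : IntegrableOn (fun y => ‖v y‖ ^ 3) T volume :=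
    ((hv.norm.pow 3).continuousOn.integrableOn_compact (isCompact_closedBall 0 (8 * L))).mono_set hTsub
  have hg : IntegrableOn (fun y => |P y| * ‖v y‖) T volume :=
    (hgc.continuousOn.integrableOn_compact (isCompact_closedBall 0 (8 * L))).mono_set hTsub
  have h2 : IntegrableOn (fun y => ‖v y‖ ^ 2) T volume :=
    ((hv.norm.pow 2).continuousOn.integrableOn_compact (isCompact_closedBall 0 (8 * L))).mono_set hTsub
  rw [integral_add hf (hg.const_mul 2), integral_const_mul]
  -- the cubic term
  have hcub : ∫ y in T, ‖v y‖ ^ 3 ≤ m * ((∫ y in ball (0 : EuclideanSpace ℝ (Fin 3)) (8 * L), ‖v y‖ ^ 2) -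
      ∫ y in ball (0 : EuclideanSpace ℝ (Fin 3)) (L / 2), ‖v y‖ ^ 2) := by
    rw [← setIntegral_shell_eq_sub (g := fun y => ‖v y‖ ^ 2) (hv.norm.pow 2) (by linarith : L / 2 ≤ 8 * L),
      ← integral_const_mul]
    refine setIntegral_mono_on hf (h2.const_mul m) hTm fun y hy => ?_
    have hvy := hm y (by linarith [hy.1]) (by linarith [hy.2])
    have h0 : 0 ≤ ‖v y‖ := norm_nonneg _
    nlinarith [sq_nonneg ‖v y‖]
  -- the pressure term over the four shells
  have hX : ∀ ℓ : ℝ, 0 ≤ ℓ → ∫ y in {y : EuclideanSpace ℝ (Fin 3) | ℓ < ‖y‖ ∧ ‖y‖ < 2 * ℓ}, |P y| * ‖v y‖ =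
      (∫ y in ball (0 : EuclideanSpace ℝ (Fin 3)) (2 * ℓ), |P y| * ‖v y‖) -
        ∫ y in ball (0 : EuclideanSpace ℝ (Fin 3)) ℓ, |P y| * ‖v y‖ := by
    intro ℓ hℓ
    rw [← setIntegral_shell_eq_open, setIntegral_shell_eq_sub hgc (by linarith : ℓ ≤ 2 * ℓ)]
  have hXT : ∫ y in T, |P y| * ‖v y‖ =
      (∫ y in ball (0 : EuclideanSpace ℝ (Fin 3)) (8 * L), |P y| * ‖v y‖) -
        ∫ y in ball (0 : EuclideanSpace ℝ (Fin 3)) (L / 2), |P y| * ‖v y‖ :=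
    setIntegral_shell_eq_sub hgc (by linarith : L / 2 ≤ 8 * L)
  have e1 := hX (L / 2) (by linarith)
  have e2 := hX L hL.le
  have e3 := hX (2 * L) (by linarith)
  have e4 := hX (4 * L) (by linarith)
  rw [show (2 : ℝ) * (L / 2) = L by ring] at e1
  rw [show (2 : ℝ) * (2 * L) = 4 * L by ring] at e3
  rw [show (2 : ℝ) * (4 * L) = 8 * L by ring] at e4
  rw [show (2 : ℝ) * (L / 2) = L by ring, show (2 : ℝ) * (2 * L) = 4 * L by ring,
    show (2 : ℝ) * (4 * L) = 8 * L by ring]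
  linarith

/-- The coefficients of the one-shell pressure bound for `ℓ ∈ [L/2, 4L]` under bounded energies
`E ≤ C_E` and the far-weight bound `∫_{|z|≥4ℓ}|v|²/|z|³ ≤ (8/7) C_E/(4ℓ)³`:
`X ≤ (C₂ m + 11 C_E L⁻³ b) · ∫_{ℓ/2≤|z|<4ℓ}|v|²` (uses `π > 3`). [folklore] -/
private theorem shell_coefficient_bound {X SD SA E₁ Φ C₂ m b C_E L ℓ : ℝ}
    (h : X ≤ C₂ * m / 2 * (SD + SA) + (4 / (Real.pi * ℓ ^ 3) * E₁ + 4 / Real.pi * Φ) * b * SD)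
    (hL : 0 < L) (hℓ1 : L / 2 ≤ ℓ) (hC₂ : 0 ≤ C₂) (hm : 0 ≤ m) (hb : 0 ≤ b)
    (hSD0 : 0 ≤ SD) (hSDSA : SD ≤ SA) (hE₁0 : 0 ≤ E₁) (hE₁ : E₁ ≤ C_E) (hΦ0 : 0 ≤ Φ)
    (hΦ : Φ ≤ 8 / 7 * C_E / (4 * ℓ) ^ 3) :
    X ≤ (C₂ * m + 11 * C_E / L ^ 3 * b) * SA := by
  have hπ := Real.pi_gt_three
  have hℓ0 : 0 < ℓ := by linarith
  have hCE0 : 0 ≤ C_E := hE₁0.trans hE₁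
  have hq : 0 ≤ C_E / L ^ 3 := by positivity
  have hℓ3 : L ^ 3 / 8 ≤ ℓ ^ 3 := by
    have := pow_le_pow_left₀ (by positivity : 0 ≤ L / 2) hℓ1 3
    calc L ^ 3 / 8 = (L / 2) ^ 3 := by ring
      _ ≤ ℓ ^ 3 := this
  have h2L : (2 * L) ^ 3 ≤ (4 * ℓ) ^ 3 := pow_le_pow_left₀ (by positivity) (by linarith) 3
  have i1 : 4 / (Real.pi * ℓ ^ 3) ≤ 4 / (3 * (L ^ 3 / 8)) :=
    div_le_div_of_nonneg_left (by norm_num) (by positivity)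
      (mul_le_mul hπ.le hℓ3 (by positivity) Real.pi_pos.le)
  have i2 : 4 / Real.pi ≤ 4 / 3 := div_le_div_of_nonneg_left (by norm_num) three_pos hπ.le
  have i3 : 8 / 7 * C_E / (4 * ℓ) ^ 3 ≤ 8 / 7 * C_E / (2 * L) ^ 3 :=
    div_le_div_of_nonneg_left (by positivity) (by positivity) h2L
  have hM : 4 / (Real.pi * ℓ ^ 3) * E₁ + 4 / Real.pi * Φ ≤ 11 * C_E / L ^ 3 :=
    calc 4 / (Real.pi * ℓ ^ 3) * E₁ + 4 / Real.pi * Φ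
        ≤ 4 / (3 * (L ^ 3 / 8)) * C_E + 4 / 3 * (8 / 7 * C_E / (2 * L) ^ 3) :=
          add_le_add (mul_le_mul i1 hE₁ hE₁0 (by positivity))
            (mul_le_mul i2 (hΦ.trans i3) hΦ0 (by positivity))
      _ = 228 / 21 * (C_E / L ^ 3) := by
          field_simp
          ring
      _ ≤ 11 * (C_E / L ^ 3) := mul_le_mul_of_nonneg_right (by norm_num) hq
      _ = 11 * C_E / L ^ 3 := (mul_div_assoc _ _ _).symm
  have hM0 : 0 ≤ 4 / (Real.pi * ℓ ^ 3) * E₁ + 4 / Real.pi * Φ := by positivity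
  have t1 : C₂ * m / 2 * (SD + SA) ≤ C₂ * m / 2 * (2 * SA) :=
    mul_le_mul_of_nonneg_left (by linarith) (by positivity)
  have t2 : (4 / (Real.pi * ℓ ^ 3) * E₁ + 4 / Real.pi * Φ) * b * SD ≤ 11 * C_E / L ^ 3 * b * SA :=
    mul_le_mul (mul_le_mul_of_nonneg_right hM hb) hSDSA hSD0 (by positivity)
  calc X ≤ _ := h
    _ ≤ C₂ * m / 2 * (2 * SA) + 11 * C_E / L ^ 3 * b * SA := add_le_add t1 t2
    _ = (C₂ * m + 11 * C_E / L ^ 3 * b) * SA := by ring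

/-! ## CS13 §3.1: the estimate (K) — one step of the iteration -/

/-- **Chae–Shvydkoy 2013, §3.1, "(tech10)" with the pressure estimates: the estimate (K).** For a
`C²` profile `(v, P)` at `α = 3/2` with eventually bounded ball energies, the shell representation of
`P` (`P = p̃[1_{A_L} v] + J₁ + J₃` on `{L < |y| < 2L}`, every `L > 0`) and the (normalised) power
spread `|v(y)| ≤ C'|y||y|^{−δ}`, `c|y|^{δ}/|y|⁴ ≤ |v(y)|` for `|y| ≥ R'` (`0 < δ ≤ 1`), "there exists
a constant `C > 0` such that for all `L` large enough
`∫_{L≤|y|≤2L}|v|² ≤ (C/L^δ) Σ_{k=−2}^{3} ∫_{2^kL≤|y|≤2^{k+1}L}|v|²`".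
[cite: ChaeShvydkoy2013, §3.1 (proof of Thm. 3.1, the displayed estimate before the iteration)] -/
private theorem shellEnergy_step
    {v : EuclideanSpace ℝ (Fin 3) → EuclideanSpace ℝ (Fin 3)} {P : EuclideanSpace ℝ (Fin 3) → ℝ}
    (hP : IsSelfSimilarEulerProfile (1 / ((3 / 2 : ℝ) + 1)) 0 v P)
    {C_E L_E : ℝ} (hCE : 0 ≤ C_E) (hLE : 0 < L_E)
    (hE : ∀ L, L_E ≤ L → ∫ y in ball (0 : EuclideanSpace ℝ (Fin 3)) L, ‖v y‖ ^ 2 ≤ C_E)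
    (hrepr : ∀ L : ℝ, 0 < L → ∀ y : EuclideanSpace ℝ (Fin 3), L < ‖y‖ ∧ ‖y‖ < 2 * L →
      P y = normalisedPressure
          ({z : EuclideanSpace ℝ (Fin 3) | L / 2 ≤ ‖z‖ ∧ ‖z‖ < 4 * L}.indicator v) y +
        (∫ z in ball (0 : EuclideanSpace ℝ (Fin 3)) (L / 2), pressureKernel (y - z) (v z)) +
        ∫ z in {z : EuclideanSpace ℝ (Fin 3) | 4 * L ≤ ‖z‖}, pressureKernel (y - z) (v z))
    {δ R' C' c : ℝ} (hδ : 0 < δ) (hδ1 : δ ≤ 1) (hR' : 1 ≤ R') (hC' : 0 ≤ C') (hc : 0 < c)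
    (hup : ∀ y, R' ≤ ‖y‖ → ‖v y‖ ≤ C' * ‖y‖ * ‖y‖ ^ (-δ))
    (hlow : ∀ y, R' ≤ ‖y‖ → c * ‖y‖ ^ δ / ‖y‖ ^ 4 ≤ ‖v y‖)
    {S : ℝ → ℝ}
    (hS : ∀ ℓ, S ℓ = ∫ y in {y : EuclideanSpace ℝ (Fin 3) | ℓ ≤ ‖y‖ ∧ ‖y‖ < 2 * ℓ}, ‖v y‖ ^ 2) :
    ∃ K L₀ : ℝ, 0 ≤ K ∧ 0 < L₀ ∧ ∀ L, L₀ ≤ L →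
      S L ≤ K * L ^ (-δ) * (S (L / 4) + S (L / 2) + S L + S (2 * L) + S (4 * L) + S (8 * L)) := by
  have hvc : Continuous v := hP.contDiff_velocity.continuous
  have hPc : Continuous P := hP.contDiff_pressure.continuous
  obtain ⟨C₁, hC₁0, hflux⟩ := hP.shellEnergy_le_flux_three_halves
  obtain ⟨C₂, hC₂⟩ := stein1970_normalisedPressure_ae_Lp_bound_holds 2 (by norm_num) ENNReal.ofNat_lt_top
  have hSt : ∀ w : EuclideanSpace ℝ (Fin 3) → EuclideanSpace ℝ (Fin 3), AEStronglyMeasurable w volume →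
      MemLp (fun x => ‖w x‖ ^ 2) 2 volume →
        eLpNorm (normalisedPressure w) 2 volume ≤ C₂ * eLpNorm (fun x => ‖w x‖ ^ 2) 2 volume :=
    fun w hw hw2 => (hC₂ w hw hw2).2
  have hC₂0 : 0 ≤ (C₂ : ℝ) := NNReal.zero_le_coe
  -- the energies as a function of the radius
  obtain ⟨E, hE_def⟩ : ∃ E : ℝ → ℝ, ∀ r, E r = ∫ y in ball (0 : EuclideanSpace ℝ (Fin 3)) r, ‖v y‖ ^ 2 :=
    ⟨_, fun _ => rfl⟩
  have hEall : ∀ r, E r ≤ C_E := fun r => by rw [hE_def]; exact ballEnergy_le_of_eventually hvc hE r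
  have hE0 : ∀ r, 0 ≤ E r := fun r => by rw [hE_def]; exact integral_nonneg fun _ => sq_nonneg _
  have hEmono : ∀ r s, r ≤ s → E r ≤ E s := fun r s hrs => by
    rw [hE_def, hE_def]; exact ballEnergy_mono hvc hrs
  have hSE : ∀ x, 0 ≤ x → S x = E (2 * x) - E x := fun x hx => by
    rw [hS, hE_def, hE_def]
    exact setIntegral_shell_eq_sub (g := fun y => ‖v y‖ ^ 2) (hvc.norm.pow 2) (by linarith)
  have hS0 : ∀ x, 0 ≤ S x := fun x => by rw [hS]; exact integral_nonneg fun _ => sq_nonneg _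
  -- the far weight (BS15 §2 Step 1 at `a = 3`)
  have hE' : ∀ L, L_E ≤ L →
      ∫ y in ball (0 : EuclideanSpace ℝ (Fin 3)) L, ‖v y‖ ^ 2 ≤ C_E * L ^ ((3 : ℝ) - 3) := fun L hL => by
    rw [sub_self, Real.rpow_zero, mul_one]; exact hE L hL
  have hfarR : ∀ R, L_E ≤ R →
      IntegrableOn (fun z => ‖v z‖ ^ 2 / ‖z‖ ^ 3) {z : EuclideanSpace ℝ (Fin 3) | R ≤ ‖z‖} volume ∧
        ∫ z in {z : EuclideanSpace ℝ (Fin 3) | R ≤ ‖z‖}, ‖v z‖ ^ 2 / ‖z‖ ^ 3 ≤ 8 / 7 * C_E / R ^ 3 := by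
    intro R hR
    have hR0 : 0 < R := hLE.trans_le hR
    have h := BronziShvydkoy2015.farWeight_integrableOn_and_le hvc (a := 3) (by norm_num) hCE hLE hE' hR
    refine ⟨h.1, h.2.trans_eq ?_⟩
    have h8 : (2 : ℝ) ^ (3 : ℝ) = 8 := by
      have : (2 : ℝ) ^ (3 : ℝ) = 2 ^ 3 := by exact_mod_cast Real.rpow_natCast 2 3
      rw [this]; norm_num
    have hR3 : R ^ (3 : ℝ) = R ^ 3 := by exact_mod_cast Real.rpow_natCast R 3
    rw [sub_self, Real.rpow_zero, mul_one, Real.rpow_neg (by norm_num : (0 : ℝ) ≤ 2),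
      Real.rpow_neg hR0.le, h8, hR3]
    field_simp
    norm_num
  -- the constants
  refine ⟨C₁ * (64 * C' + 512 * C₂ * C' + 352 * 16 ^ 4 * C_E / c), max (4 * R') L_E,
    by positivity, lt_max_of_lt_right hLE, fun L hL => ?_⟩
  have h4R : 4 * R' ≤ L := (le_max_left _ _).trans hL
  have hLEL : L_E ≤ L := (le_max_right _ _).trans hL
  have hL1 : 1 ≤ L := by linarith
  have hL0 : 0 < L := by linarith
  have ht0 : 0 ≤ L ^ (-δ) := Real.rpow_nonneg hL0.le _
  -- `m = sup |v|` and `b = sup |v|⁻¹` on the band `{L/4 ≤ |y| ≤ 16L}`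
  have hm0 : 0 ≤ 64 * C' * L * L ^ (-δ) := by positivity
  have hb0 : 0 ≤ 4 * 16 ^ 4 * L ^ 4 * L ^ (-δ) / c := by positivity
  have hmband : ∀ y : EuclideanSpace ℝ (Fin 3), L / 4 ≤ ‖y‖ → ‖y‖ ≤ 16 * L →
      ‖v y‖ ≤ 64 * C' * L * L ^ (-δ) := fun y hy1 hy2 =>
    norm_le_of_upperPower_band hδ.le hδ1 hR' hC' hup h4R hy1 hy2
  have hbband : ∀ y : EuclideanSpace ℝ (Fin 3), L / 4 ≤ ‖y‖ → ‖y‖ ≤ 16 * L →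
      ‖v y‖ ≤ 4 * 16 ^ 4 * L ^ 4 * L ^ (-δ) / c * ‖v y‖ ^ 2 := fun y hy1 hy2 =>
    norm_le_mul_sq_of_lowerPower_band hδ.le hδ1 hR' hc hlow h4R hy1 hy2
  -- the pressure term on each of the four shells of `T = {L/2 ≤ |y| < 8L}`
  have hshell : ∀ ℓ, L / 2 ≤ ℓ → ℓ ≤ 4 * L →
      ∫ y in {y : EuclideanSpace ℝ (Fin 3) | ℓ < ‖y‖ ∧ ‖y‖ < 2 * ℓ}, |P y| * ‖v y‖ ≤
        (C₂ * (64 * C' * L * L ^ (-δ)) + 11 * C_E / L ^ 3 * (4 * 16 ^ 4 * L ^ 4 * L ^ (-δ) / c)) *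
          (E (4 * ℓ) - E (ℓ / 2)) := by
    intro ℓ hℓ1 hℓ2
    have hℓ0 : 0 < ℓ := by linarith
    have hfar4 := hfarR (4 * ℓ) (by linarith)
    have h := shell_pressureVelocity_le_of_repr hvc hℓ0 hSt (hrepr ℓ hℓ0) hfar4.1 hm0
      (fun z hz1 hz2 => hmband z (by linarith) (by linarith))
      (fun y hy1 hy2 => hbband y (by linarith) (by linarith))
    have hSA : ∫ z in {z : EuclideanSpace ℝ (Fin 3) | ℓ / 2 ≤ ‖z‖ ∧ ‖z‖ < 4 * ℓ}, ‖v z‖ ^ 2 =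
        E (4 * ℓ) - E (ℓ / 2) := by
      rw [hE_def, hE_def]
      exact setIntegral_shell_eq_sub (g := fun y => ‖v y‖ ^ 2) (hvc.norm.pow 2) (by linarith)
    have hSD : ∫ y in {y : EuclideanSpace ℝ (Fin 3) | ℓ < ‖y‖ ∧ ‖y‖ < 2 * ℓ}, ‖v y‖ ^ 2 =
        E (2 * ℓ) - E ℓ := by
      rw [hE_def, hE_def, ← setIntegral_shell_eq_open]
      exact setIntegral_shell_eq_sub (g := fun y => ‖v y‖ ^ 2) (hvc.norm.pow 2) (by linarith)
    have hE1 : ∫ z in ball (0 : EuclideanSpace ℝ (Fin 3)) (ℓ / 2), ‖v z‖ ^ 2 = E (ℓ / 2) :=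
      (hE_def _).symm
    rw [hSA, hSD, hE1] at h
    refine shell_coefficient_bound h hL0 hℓ1 hC₂0 hm0 hb0 ?_ ?_ (hE0 _) (hEall _) ?_ hfar4.2
    · linarith [hEmono ℓ (2 * ℓ) (by linarith)]
    · linarith [hEmono (2 * ℓ) (4 * ℓ) (by linarith), hEmono (ℓ / 2) ℓ (by linarith)]
    · exact integral_nonneg fun _ => div_nonneg (sq_nonneg _) (pow_nonneg (norm_nonneg _) _)
  -- the four shells and the six dyadic energies
  have hX1 := hshell (L / 2) le_rfl (by linarith)
  have hX2 := hshell L (by linarith) (by linarith)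
  have hX3 := hshell (2 * L) (by linarith) (by linarith)
  have hX4 := hshell (4 * L) (by linarith) (by linarith)
  rw [show (4 : ℝ) * (L / 2) = 2 * L by ring, show L / 2 / 2 = L / 4 by ring] at hX1
  rw [show (2 : ℝ) * L / 2 = L by ring, show (4 : ℝ) * (2 * L) = 8 * L by ring] at hX3
  rw [show (4 : ℝ) * L / 2 = 2 * L by ring, show (4 : ℝ) * (4 * L) = 16 * L by ring] at hX4
  have s0 := hSE (L / 4) (by positivity)
  have s1 := hSE (L / 2) (by positivity)
  have s2 := hSE L hL0.le
  have s3 := hSE (2 * L) (by positivity)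
  have s4 := hSE (4 * L) (by positivity)
  have s5 := hSE (8 * L) (by positivity)
  rw [show (2 : ℝ) * (L / 4) = L / 2 by ring] at s0
  rw [show (2 : ℝ) * (L / 2) = L by ring] at s1
  rw [show (2 : ℝ) * (2 * L) = 4 * L by ring] at s3
  rw [show (2 : ℝ) * (4 * L) = 8 * L by ring] at s4
  rw [show (2 : ℝ) * (8 * L) = 16 * L by ring] at s5
  have n0 := hS0 (L / 4)
  have n1 := hS0 (L / 2)
  have n2 := hS0 L
  have n3 := hS0 (2 * L)
  have n4 := hS0 (4 * L)
  have n5 := hS0 (8 * L)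
  set σ : ℝ := S (L / 4) + S (L / 2) + S L + S (2 * L) + S (4 * L) + S (8 * L) with hσ
  have hA1 : E (2 * L) - E (L / 4) ≤ σ := by rw [hσ]; linarith
  have hA2 : E (4 * L) - E (L / 2) ≤ σ := by rw [hσ]; linarith
  have hA3 : E (8 * L) - E L ≤ σ := by rw [hσ]; linarith
  have hA4 : E (16 * L) - E (2 * L) ≤ σ := by rw [hσ]; linarith
  have hAT : E (8 * L) - E (L / 2) ≤ σ := by rw [hσ]; linarith
  set coef : ℝ := C₂ * (64 * C' * L * L ^ (-δ)) +
    11 * C_E / L ^ 3 * (4 * 16 ^ 4 * L ^ 4 * L ^ (-δ) / c) with hcoef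
  have hcoef0 : 0 ≤ coef := by positivity
  have hX1' := hX1.trans (mul_le_mul_of_nonneg_left hA1 hcoef0)
  have hX2' := hX2.trans (mul_le_mul_of_nonneg_left hA2 hcoef0)
  have hX3' := hX3.trans (mul_le_mul_of_nonneg_left hA3 hcoef0)
  have hX4' := hX4.trans (mul_le_mul_of_nonneg_left hA4 hcoef0)
  -- the flux split and the assembly
  have hsplit := flux_split (P := P) hvc hPc hL0 hmband
  rw [← hE_def, ← hE_def] at hsplit
  have hcub : 64 * C' * L * L ^ (-δ) * (E (8 * L) - E (L / 2)) ≤ 64 * C' * L * L ^ (-δ) * σ :=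
    mul_le_mul_of_nonneg_left hAT hm0
  have hinner : ∫ y in {y : EuclideanSpace ℝ (Fin 3) | L / 2 ≤ ‖y‖ ∧ ‖y‖ < 8 * L},
      (‖v y‖ ^ 3 + 2 * (|P y| * ‖v y‖)) ≤ 64 * C' * L * L ^ (-δ) * σ + 8 * (coef * σ) := by
    linarith
  have hSL := hflux L hL0
  rw [← hS] at hSL
  have hC₁L : 0 ≤ C₁ * L⁻¹ := by positivity
  calc S L ≤ C₁ * L⁻¹ * ∫ y in {y : EuclideanSpace ℝ (Fin 3) | L / 2 ≤ ‖y‖ ∧ ‖y‖ < 8 * L},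
        (‖v y‖ ^ 3 + 2 * (|P y| * ‖v y‖)) := hSL
    _ ≤ C₁ * L⁻¹ * (64 * C' * L * L ^ (-δ) * σ + 8 * (coef * σ)) :=
        mul_le_mul_of_nonneg_left hinner hC₁L
    _ = C₁ * (64 * C' + 512 * C₂ * C' + 352 * 16 ^ 4 * C_E / c) * L ^ (-δ) * σ := by
        rw [hcoef]
        field_simp
        ring

/-! ## CS13 Theorem 3.1 -/

/-- The far weight of a continuous field, integrable beyond some radius `R₀`, is integrable on
`{|z| ≥ 1}` (the annulus `{1 ≤ |z| ≤ R₀}` is compact and avoids the origin). [folklore] -/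
private theorem integrableOn_farWeight_one
    {v : EuclideanSpace ℝ (Fin 3) → EuclideanSpace ℝ (Fin 3)} (hv : Continuous v) {R₀ : ℝ}
    (hfar : IntegrableOn (fun z => ‖v z‖ ^ 2 / ‖z‖ ^ 3) {z : EuclideanSpace ℝ (Fin 3) | R₀ ≤ ‖z‖} volume) :
    IntegrableOn (fun z => ‖v z‖ ^ 2 / ‖z‖ ^ 3) {z : EuclideanSpace ℝ (Fin 3) | 1 ≤ ‖z‖} volume := by
  have hK : IsCompact {z : EuclideanSpace ℝ (Fin 3) | 1 ≤ ‖z‖ ∧ ‖z‖ ≤ R₀} := by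
    refine (isCompact_closedBall (0 : EuclideanSpace ℝ (Fin 3)) R₀).of_isClosed_subset
      ((isClosed_le continuous_const continuous_norm).inter (isClosed_le continuous_norm continuous_const))
      fun z hz => ?_
    rw [mem_closedBall_zero_iff]; exact hz.2
  have hcont : ContinuousOn (fun z : EuclideanSpace ℝ (Fin 3) => ‖v z‖ ^ 2 / ‖z‖ ^ 3)
      {z | 1 ≤ ‖z‖ ∧ ‖z‖ ≤ R₀} := by
    refine ((hv.norm.pow 2).continuousOn).div (continuous_norm.pow 3).continuousOn fun z hz => ?_
    exact (pow_pos (zero_lt_one.trans_le hz.1) 3).ne'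
  refine ((hcont.integrableOn_compact hK).union hfar).mono_set fun z hz => ?_
  by_cases h : ‖z‖ ≤ R₀
  · exact Or.inl ⟨hz, h⟩
  · exact Or.inr (le_of_lt (not_le.1 h))

/-- **Chae–Shvydkoy 2013, Theorem 3.1, at the level of the profile.** Let `(v, P)` be a `C²`
self-similar Euler profile at the energy-conserving scaling `α = N/2 = 3/2` (`γ = 1/(α+1) = 2/5`)
whose ball energies are eventually bounded (`∫_{|y|<L}|v|² ≤ C_E`, `L ≥ L_E` — "`v ∈ L²`") and
whose pressure has, on every dyadic shell, the split Riesz representation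
`P = p̃[1_{A_L}v] + J₁ + J₃` ("the pressure `q` given by (q)"; the tree's
`BronziShvydkoy2015.exists_pressureProfile_shell_repr`). "Suppose there exists a `δ > 0` and
`C, c > 0` such that `c/|y|^{N+1−δ} ≤ |v(y)| ≤ C|y|^{1−δ}` for all sufficiently large `y`. Then
`v = 0`." (The hypotheses are in fact contradictory: the printed claim
`∫_{L≤|y|≤2L}|v|² ≤ C_M L^{−M}` for every `M` "immediately runs into contradiction with the lower
bound".) [cite: ChaeShvydkoy2013, §3.1 Thm. 3.1] -/
theorem IsSelfSimilarEulerProfile.eq_zero_of_powerSpread_of_shellRepr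
    {v : EuclideanSpace ℝ (Fin 3) → EuclideanSpace ℝ (Fin 3)} {P : EuclideanSpace ℝ (Fin 3) → ℝ}
    (hP : IsSelfSimilarEulerProfile (2 / 5) 0 v P)
    {C_E L_E : ℝ} (hCE : 0 ≤ C_E) (hLE : 0 < L_E)
    (hE : ∀ L, L_E ≤ L → ∫ y in ball (0 : EuclideanSpace ℝ (Fin 3)) L, ‖v y‖ ^ 2 ≤ C_E)
    (hrepr : ∀ L : ℝ, 0 < L → ∀ y : EuclideanSpace ℝ (Fin 3), L < ‖y‖ ∧ ‖y‖ < 2 * L →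
      P y = normalisedPressure
          ({z : EuclideanSpace ℝ (Fin 3) | L / 2 ≤ ‖z‖ ∧ ‖z‖ < 4 * L}.indicator v) y +
        (∫ z in ball (0 : EuclideanSpace ℝ (Fin 3)) (L / 2), pressureKernel (y - z) (v z)) +
        ∫ z in {z : EuclideanSpace ℝ (Fin 3) | 4 * L ≤ ‖z‖}, pressureKernel (y - z) (v z))
    {δ R C c : ℝ} (hδ : 0 < δ) (hc : 0 < c)
    (hup : ∀ y : EuclideanSpace ℝ (Fin 3), R ≤ ‖y‖ → ‖v y‖ ≤ C * ‖y‖ ^ (1 - δ))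
    (hlow : ∀ y : EuclideanSpace ℝ (Fin 3), R ≤ ‖y‖ → c * ‖y‖ ^ (-(4 - δ)) ≤ ‖v y‖) :
    v = 0 := by
  have hP' : IsSelfSimilarEulerProfile (1 / ((3 / 2 : ℝ) + 1)) 0 v P := by norm_num; exact hP
  have hvc : Continuous v := hP.contDiff_velocity.continuous
  obtain ⟨δ', R', C', hδ'0, hδ'1, hR'1, hC'0, hup', hlow'⟩ := powerSpread_normalise hδ hc.le hup hlow
  obtain ⟨S, hS⟩ : ∃ S : ℝ → ℝ, ∀ ℓ, S ℓ =
      ∫ y in {y : EuclideanSpace ℝ (Fin 3) | ℓ ≤ ‖y‖ ∧ ‖y‖ < 2 * ℓ}, ‖v y‖ ^ 2 := ⟨_, fun _ => rfl⟩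
  obtain ⟨K, L₀, hK0, hL₀0, hstep⟩ :=
    shellEnergy_step hP' hCE hLE hE hrepr hδ'0 hδ'1 hR'1 hC'0 hc hup' hlow' hS
  -- the shell energies are bounded by `C_E`
  have hEall := ballEnergy_le_of_eventually hvc hE
  have hSB : ∀ ℓ, 0 < ℓ → S ℓ ≤ C_E := fun ℓ hℓ => by
    rw [hS, setIntegral_shell_eq_sub (g := fun y => ‖v y‖ ^ 2) (hvc.norm.pow 2) (by linarith)]
    have h0 : 0 ≤ ∫ y in ball (0 : EuclideanSpace ℝ (Fin 3)) ℓ, ‖v y‖ ^ 2 :=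
      integral_nonneg fun _ => sq_nonneg _
    linarith [hEall (2 * ℓ)]
  -- the iteration, `m δ' ≥ 6` times
  obtain ⟨Bm, hBm0, hBm⟩ := iterate_shellDecay hδ'0.le hK0 hL₀0 hCE hSB hstep ⌈6 / δ'⌉₊
  have hmδ : 6 ≤ (⌈6 / δ'⌉₊ : ℝ) * δ' := by
    have h1 : 6 / δ' ≤ (⌈6 / δ'⌉₊ : ℝ) := Nat.le_ceil _
    rwa [div_le_iff₀ hδ'0] at h1
  -- the lower bound constant
  have hv1 : 0 < (volume : Measure (EuclideanSpace ℝ (Fin 3))).real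
      (closedBall (0 : EuclideanSpace ℝ (Fin 3)) 1) := by
    rw [measureReal_def]
    exact ENNReal.toReal_pos (measure_closedBall_pos volume _ one_pos).ne' measure_closedBall_lt_top.ne
  set A : ℝ := 7 * (volume : Measure (EuclideanSpace ℝ (Fin 3))).real
      (closedBall (0 : EuclideanSpace ℝ (Fin 3)) 1) * c ^ 2 with hA
  have hA0 : 0 < A := by positivity
  -- a radius beyond all thresholds
  set L : ℝ := max (max (4 ^ ⌈6 / δ'⌉₊ * L₀) R') (256 * (Bm + 1) / A) with hLdef
  have hL1 : 4 ^ ⌈6 / δ'⌉₊ * L₀ ≤ L := (le_max_left _ _).trans (le_max_left _ _)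
  have hL2 : R' ≤ L := (le_max_right _ _).trans (le_max_left _ _)
  have hL3 : 256 * (Bm + 1) / A ≤ L := le_max_right _ _
  have hLone : 1 ≤ L := hR'1.trans hL2
  have hL0 : 0 < L := one_pos.trans_le hLone
  have hupL := hBm L hL1
  have hlowL := shellEnergy_lower_bound hvc hδ'0.le hc.le hR'1 hL2 hlow'
  rw [← hS] at hlowL
  have hpow : L ^ (-((⌈6 / δ'⌉₊ : ℝ) * δ')) ≤ (L ^ 6)⁻¹ := by
    have h6 : L ^ (6 : ℝ) = L ^ 6 := by exact_mod_cast Real.rpow_natCast L 6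
    calc L ^ (-((⌈6 / δ'⌉₊ : ℝ) * δ')) ≤ L ^ (-(6 : ℝ)) :=
          Real.rpow_le_rpow_of_exponent_le hLone (by linarith)
      _ = (L ^ 6)⁻¹ := by rw [Real.rpow_neg hL0.le, h6]
  have h1 : A / (256 * L ^ 5) ≤ Bm * (L ^ 6)⁻¹ :=
    hlowL.trans (hupL.trans (mul_le_mul_of_nonneg_left hpow hBm0))
  have key : A * L ≤ 256 * Bm := by
    have h := mul_le_mul_of_nonneg_right h1 (by positivity : (0 : ℝ) ≤ 256 * L ^ 6)
    have e1 : A / (256 * L ^ 5) * (256 * L ^ 6) = A * L := by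
      field_simp
    have e2 : Bm * (L ^ 6)⁻¹ * (256 * L ^ 6) = 256 * Bm := by
      field_simp
    rwa [e1, e2] at h
  have key' : 256 * (Bm + 1) ≤ A * L := by
    have := (div_le_iff₀ hA0).1 hL3
    linarith
  exfalso
  linarith

/-- **Chae–Shvydkoy 2013, Theorem 3.1 — no locally self-similar Euler blow-up at the
energy-conserving scaling has a profile with a power spread.** Let `u` be a classical Euler solution
on `ℝ³ × [0,T)` in the Beale–Kato–Majda class, locally self-similar on `B_{ρ₀}(x₀)`:
`u(x,t) = (T−t)^{−α/(1+α)} v((x−x₀)(T−t)^{−1/(1+α)})` with `α = N/2 = 3/2` (collapse exponent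
`1/(α+1) = 2/5`), `C²` profile `v`. "Suppose there exists a `δ > 0` and `C, c > 0` such that
`c/|y|^{N+1−δ} ≤ |v(y)| ≤ C|y|^{1−δ}` for all sufficiently large `y`. Then `v = 0`." The profile's
standing data of §3 — `v ∈ L²` (here: bounded ball energies, by the energy growth (1.6)
`energyGrowth_of_locallySelfSimilar` at `α = 3/2`) and "the pressure `q` given by (q)" (here: the
shell representation `BronziShvydkoy2015.exists_pressureProfile_shell_repr` of the recovered profile
pressure) — are DERIVED from the ambient solution; the printed regularity `v ∈ C¹_loc` is
strengthened to `C²` (what the tree's pressure recovery uses).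
[cite: ChaeShvydkoy2013, §3.1 Thm. 3.1] -/
theorem eq_zero_of_locallySelfSimilar_energyConserving_of_powerSpread
    {T ρ₀ : ℝ} {x₀ : EuclideanSpace ℝ (Fin 3)}
    {u : ℝ → EuclideanSpace ℝ (Fin 3) → EuclideanSpace ℝ (Fin 3)} {p : ℝ → EuclideanSpace ℝ (Fin 3) → ℝ}
    {v : EuclideanSpace ℝ (Fin 3) → EuclideanSpace ℝ (Fin 3)}
    (hT : 0 < T) (hρ₀ : 0 < ρ₀) (hsol : IsClassicalEulerSolutionOn (Ico 0 T) 0 u p)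
    (hreg : ∀ T'' < T, HasBoundedSobolevNormsOn (Icc 0 T'') u) (hv : ContDiff ℝ 2 v)
    (hss : ∀ t ∈ Ico 0 T, ∀ x ∈ ball x₀ ρ₀, u t x = selfSimilarCollapse (2 / 5) T v t (x - x₀))
    {δ R C c : ℝ} (hδ : 0 < δ) (hc : 0 < c)
    (hup : ∀ y : EuclideanSpace ℝ (Fin 3), R ≤ ‖y‖ → ‖v y‖ ≤ C * ‖y‖ ^ (1 - δ))
    (hlow : ∀ y : EuclideanSpace ℝ (Fin 3), R ≤ ‖y‖ → c * ‖y‖ ^ (-(4 - δ)) ≤ ‖v y‖) :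
    v = 0 := by
  have hγ : (1 : ℝ) / ((3 / 2 : ℝ) + 1) = 2 / 5 := by norm_num
  have hss' : ∀ t ∈ Ico 0 T, ∀ x ∈ ball x₀ ρ₀,
      u t x = selfSimilarCollapse (1 / ((3 / 2 : ℝ) + 1)) T v t (x - x₀) := by
    rw [hγ]; exact hss
  have hvc : Continuous v := hv.continuous
  have hE₀ : 0 ≤ ∫ x, ‖u 0 x‖ ^ 2 := integral_nonneg fun _ => sq_nonneg _
  have hLE : 0 < max (ρ₀ * T ^ (-(1 / ((3 / 2 : ℝ) + 1)))) 1 := lt_max_of_lt_right one_pos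
  have hE : ∀ L, max (ρ₀ * T ^ (-(1 / ((3 / 2 : ℝ) + 1)))) 1 ≤ L →
      ∫ y in ball (0 : EuclideanSpace ℝ (Fin 3)) L, ‖v y‖ ^ 2 ≤ ∫ x, ‖u 0 x‖ ^ 2 := by
    intro L hL
    have h := energyGrowth_of_locallySelfSimilar hT (by norm_num : (-1 : ℝ) < 3 / 2) hρ₀ hsol hreg hss'
      ((le_max_left _ _).trans hL)
    rw [show (2 : ℝ) * (3 / 2) - 3 = 0 by norm_num, show (3 : ℝ) - 2 * (3 / 2) = 0 by norm_num,
      Real.rpow_zero, Real.rpow_zero, mul_one, mul_one] at h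
    exact h
  -- the far weight on `{|z| ≥ 1}` (BS15 §2 Step 1) and the shell representation (BS15 Lemma 2.1)
  have hE' : ∀ L, max (ρ₀ * T ^ (-(1 / ((3 / 2 : ℝ) + 1)))) 1 ≤ L →
      ∫ y in ball (0 : EuclideanSpace ℝ (Fin 3)) L, ‖v y‖ ^ 2 ≤ (∫ x, ‖u 0 x‖ ^ 2) * L ^ ((3 : ℝ) - 3) :=
    fun L hL => by rw [sub_self, Real.rpow_zero, mul_one]; exact hE L hL
  have hfarE := (BronziShvydkoy2015.farWeight_integrableOn_and_le hvc (a := 3) (by norm_num) hE₀ hLE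
    hE' le_rfl).1
  have hfar1 := integrableOn_farWeight_one hvc hfarE
  obtain ⟨P, hP, hPl⟩ := BronziShvydkoy2015.exists_pressureProfile_shell_repr hT
    (by norm_num : (0 : ℝ) < 2 / 5) (by norm_num : (2 / 5 : ℝ) < 1) hρ₀ hsol hreg hv hss hfar1
  exact hP.eq_zero_of_powerSpread_of_shellRepr hE₀ hLE hE hPl hδ hc hup hlow

/-- **Corollary (the exclusion read as a non-existence statement).** In the setting of
`eq_zero_of_locallySelfSimilar_energyConserving_of_powerSpread`, a profile with the upper power
bound `|v(y)| ≤ C|y|^{1−δ}` for `|y| ≥ R` admits NO lower power bound `c|y|^{−(4−δ)} ≤ |v(y)|`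
(`c > 0`) on `|y| ≥ R`: the two bounds are incompatible for a locally self-similar blow-up profile at
`α = 3/2`. [cite: ChaeShvydkoy2013, §3.1 Thm. 3.1] -/
theorem not_powerSpread_of_locallySelfSimilar_energyConserving
    {T ρ₀ : ℝ} {x₀ : EuclideanSpace ℝ (Fin 3)}
    {u : ℝ → EuclideanSpace ℝ (Fin 3) → EuclideanSpace ℝ (Fin 3)} {p : ℝ → EuclideanSpace ℝ (Fin 3) → ℝ}
    {v : EuclideanSpace ℝ (Fin 3) → EuclideanSpace ℝ (Fin 3)}
    (hT : 0 < T) (hρ₀ : 0 < ρ₀) (hsol : IsClassicalEulerSolutionOn (Ico 0 T) 0 u p)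
    (hreg : ∀ T'' < T, HasBoundedSobolevNormsOn (Icc 0 T'') u) (hv : ContDiff ℝ 2 v)
    (hss : ∀ t ∈ Ico 0 T, ∀ x ∈ ball x₀ ρ₀, u t x = selfSimilarCollapse (2 / 5) T v t (x - x₀))
    {δ R C c : ℝ} (hδ : 0 < δ) (hc : 0 < c)
    (hup : ∀ y : EuclideanSpace ℝ (Fin 3), R ≤ ‖y‖ → ‖v y‖ ≤ C * ‖y‖ ^ (1 - δ)) :
    ¬ ∀ y : EuclideanSpace ℝ (Fin 3), R ≤ ‖y‖ → c * ‖y‖ ^ (-(4 - δ)) ≤ ‖v y‖ := by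
  intro hlow
  have hv0 := eq_zero_of_locallySelfSimilar_energyConserving_of_powerSpread hT hρ₀ hsol hreg hv hss hδ hc
    hup hlow
  -- at a point `y` with `|y| ≥ max R 1` the lower bound is positive, the profile vanishes
  obtain ⟨y, hy⟩ : ∃ y : EuclideanSpace ℝ (Fin 3), max R 1 ≤ ‖y‖ := by
    obtain ⟨e, he⟩ := exists_ne (0 : EuclideanSpace ℝ (Fin 3))
    have he0 : 0 < ‖e‖ := norm_pos_iff.2 he
    refine ⟨(max R 1 / ‖e‖) • e, ?_⟩
    rw [norm_smul, Real.norm_eq_abs, abs_of_nonneg (by positivity), div_mul_cancel₀ _ he0.ne']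
  have hy1 : 1 ≤ ‖y‖ := (le_max_right _ _).trans hy
  have h := hlow y ((le_max_left _ _).trans hy)
  rw [hv0, Pi.zero_apply, norm_zero] at h
  have : 0 < c * ‖y‖ ^ (-(4 - δ)) := mul_pos hc (Real.rpow_pos_of_pos (by linarith) _)
  linarith

/-! ## CS13 Theorem 3.1 as printed at the level of the profile: `v ∈ L²(ℝ³)` and "the pressure
`q` given by (q)" -/

/-- The profile system sees the pressure only through its gradient: `P ↦ P + κ` preserves it.
[cite: ChaeShvydkoy2013, §2 eq. (2.2)–(2.3) (the pressure enters through `∇q`)] -/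
theorem IsSelfSimilarEulerProfile.add_const {γ κ : ℝ} {c : EuclideanSpace ℝ (Fin 3)}
    {U : EuclideanSpace ℝ (Fin 3) → EuclideanSpace ℝ (Fin 3)} {P : EuclideanSpace ℝ (Fin 3) → ℝ}
    (h : IsSelfSimilarEulerProfile γ c U P) :
    IsSelfSimilarEulerProfile γ c U (fun y => P y + κ) where
  contDiff_velocity := h.contDiff_velocity
  contDiff_pressure := h.contDiff_pressure.add contDiff_const
  profile_eq y := by
    have hg : gradient (fun y => P y + κ) y = gradient P y := by
      unfold gradient
      rw [fderiv_add_const]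
    rw [hg]
    exact h.profile_eq y
  divFree := h.divFree

/-- Finite energy in the `∫⁻ ‖·‖ₑ²` form (the hypothesis shape of `hasPressurePV_of_contDiff`).
[folklore] -/
private theorem lintegral_enorm_sq_lt_top_of_integrable_normSq
    {f : EuclideanSpace ℝ (Fin 3) → EuclideanSpace ℝ (Fin 3)}
    (hf : Integrable (fun z => ‖f z‖ ^ 2)) : (∫⁻ z, ‖f z‖ₑ ^ 2) < ⊤ := by
  have e : ∀ z, ‖f z‖ₑ ^ 2 = ENNReal.ofReal (‖f z‖ ^ 2) := fun z => by
    rw [← ofReal_norm, ENNReal.ofReal_pow (norm_nonneg _)]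
  simp_rw [e]
  rw [← ofReal_integral_eq_lintegral_ofReal hf (Eventually.of_forall fun z => sq_nonneg _)]
  exact ENNReal.ofReal_lt_top

/-- The far weight of a finite-energy field is integrable on `{|z| ≥ R}`, `R > 0`
(`|f|²/|z|³ ≤ R⁻³|f|²` there). [folklore] -/
private theorem integrableOn_farWeight_of_integrable_normSq
    {f : EuclideanSpace ℝ (Fin 3) → EuclideanSpace ℝ (Fin 3)}
    (hf : Continuous f) (hf2 : Integrable (fun z => ‖f z‖ ^ 2)) {R : ℝ} (hR : 0 < R) :
    IntegrableOn (fun z => ‖f z‖ ^ 2 / ‖z‖ ^ 3) {z : EuclideanSpace ℝ (Fin 3) | R ≤ ‖z‖} volume := by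
  have hm : MeasurableSet {z : EuclideanSpace ℝ (Fin 3) | R ≤ ‖z‖} :=
    (isClosed_le continuous_const continuous_norm).measurableSet
  refine Integrable.mono' ((hf2.integrableOn).const_mul (R⁻¹ ^ 3))
    ((hf.norm.pow 2).measurable.div (continuous_norm.pow 3).measurable).aestronglyMeasurable.restrict ?_
  rw [ae_restrict_iff' hm]
  refine Eventually.of_forall fun z hz => ?_
  have hz0 : 0 < ‖z‖ := hR.trans_le hz
  rw [Real.norm_eq_abs, abs_of_nonneg (div_nonneg (sq_nonneg _) (pow_nonneg hz0.le _)),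
    div_eq_mul_inv, mul_comm]
  refine mul_le_mul_of_nonneg_right ?_ (sq_nonneg _)
  rw [← inv_pow]
  exact pow_le_pow_left₀ (inv_nonneg.2 hz0.le) ((inv_le_inv₀ hz0 hR).2 hz) 3

/-- **Chae–Shvydkoy 2013, Theorem 3.1, as printed (profile level).** "Let `v ∈ L²(ℝ^N) ∩ C¹_loc`
and the pressure `q` given by (q)" — here: `(v, P)` a `C²` self-similar Euler profile at the
energy-conserving scaling `α = N/2 = 3/2` (`γ = 2/5`), `v ∈ L²(ℝ³)`, and `P` equal to the Riesz
pressure `p̃[v] = −|v|²/3 + p.v. K ∗ (v ⊗ v)` (the tree's `normalisedPressure v`, formula (q)) up to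
an additive constant (the profile system only sees `∇q`). "Suppose there exists a `δ > 0` and
`C, c > 0` such that `c/|y|^{N+1−δ} ≤ |v(y)| ≤ C|y|^{1−δ}` for all sufficiently large `y`. Then
`v = 0`." Reduction to `eq_zero_of_powerSpread_of_shellRepr`: the ball energies are bounded by
`‖v‖₂²`, the principal values exist everywhere (`hasPressurePV_of_contDiff_holds`, `v ∈ C¹ ∩ L²`),
and `p̃[v]` splits on every dyadic shell (`BronziShvydkoy2015.normalisedPressure_eq_indicator_add`).
[cite: ChaeShvydkoy2013, §3.1 Thm. 3.1] -/
theorem IsSelfSimilarEulerProfile.eq_zero_of_memLp_two_of_powerSpread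
    {v : EuclideanSpace ℝ (Fin 3) → EuclideanSpace ℝ (Fin 3)} {P : EuclideanSpace ℝ (Fin 3) → ℝ}
    (hP : IsSelfSimilarEulerProfile (2 / 5) 0 v P) (hv2 : MemLp v 2 volume) {κ : ℝ}
    (hq : ∀ y : EuclideanSpace ℝ (Fin 3), P y = normalisedPressure v y + κ)
    {δ R C c : ℝ} (hδ : 0 < δ) (hc : 0 < c)
    (hup : ∀ y : EuclideanSpace ℝ (Fin 3), R ≤ ‖y‖ → ‖v y‖ ≤ C * ‖y‖ ^ (1 - δ))
    (hlow : ∀ y : EuclideanSpace ℝ (Fin 3), R ≤ ‖y‖ → c * ‖y‖ ^ (-(4 - δ)) ≤ ‖v y‖) :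
    v = 0 := by
  have hvc : Continuous v := hP.contDiff_velocity.continuous
  have hv1 : ContDiff ℝ 1 v := hP.contDiff_velocity.of_le (by norm_num)
  have hint : Integrable (fun z => ‖v z‖ ^ 2) volume :=
    (memLp_two_iff_integrable_sq_norm hvc.aestronglyMeasurable).1 hv2
  have hPV : ∀ x : EuclideanSpace ℝ (Fin 3), ∃ Λ, HasPressurePV v x Λ :=
    hasPressurePV_of_contDiff_holds v hv1 (lintegral_enorm_sq_lt_top_of_integrable_normSq hint)
  -- the pressure normalised by the constant, and its dyadic shell representation
  have hP' : IsSelfSimilarEulerProfile (2 / 5) 0 v (fun y => P y + -κ) := hP.add_const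
  have hrepr : ∀ L : ℝ, 0 < L → ∀ y : EuclideanSpace ℝ (Fin 3), L < ‖y‖ ∧ ‖y‖ < 2 * L →
      (fun y => P y + -κ) y = normalisedPressure
          ({z : EuclideanSpace ℝ (Fin 3) | L / 2 ≤ ‖z‖ ∧ ‖z‖ < 4 * L}.indicator v) y +
        (∫ z in ball (0 : EuclideanSpace ℝ (Fin 3)) (L / 2), pressureKernel (y - z) (v z)) +
        ∫ z in {z : EuclideanSpace ℝ (Fin 3) | 4 * L ≤ ‖z‖}, pressureKernel (y - z) (v z) := by
    intro L hL y hy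
    show P y + -κ = _
    rw [hq y, add_neg_cancel_right]
    exact BronziShvydkoy2015.normalisedPressure_eq_indicator_add hvc.aestronglyMeasurable hL hy (hPV y)
      hint.integrableOn (integrableOn_farWeight_of_integrable_normSq hvc hint (by linarith))
  -- the ball energies are bounded by the total energy
  have hE : ∀ L : ℝ, (1 : ℝ) ≤ L →
      ∫ y in ball (0 : EuclideanSpace ℝ (Fin 3)) L, ‖v y‖ ^ 2 ≤ ∫ y, ‖v y‖ ^ 2 := fun L _ =>
    setIntegral_le_integral hint (Eventually.of_forall fun _ => sq_nonneg _)
  exact hP'.eq_zero_of_powerSpread_of_shellRepr (integral_nonneg fun _ => sq_nonneg _) one_pos hE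
    hrepr hδ hc hup hlow

end Literature.Analysis.FluidPDE
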